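import Literature.NumberTheory.ConnesConsani2021.SoninProjection
import Literature.NumberTheory.ConnesConsani2021.SchwartzKernels
import Literature.NumberTheory.ConnesConsani2021.SemilocalSoninSpace
import Literature.NumberTheory.LFunctions.ProlateExistsUnique
import Literature.NumberTheory.LFunctions.ProlateParity
import Literature.Analysis.OperatorTheory.TightSupNormCompactOperator
import Literature.Analysis.FluidPDE.NSFourierPlancherel
import HarnessLib

/-!
# Connes–Consani 2021, §4 (first part): the cutoff projections `𝒫₁`, `𝒫̂₁`, the angle operator, and the prolate vectors `ξ_n, η_n, ψ_n, ζ_n` — STATEMENT LAYER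

RH-FREE corpus literature (archimedean place only; no zeta zeros, no Weil positivity, no claim
about RH anywhere in this file).  Cell `rh-crit`, sub-cell `cc/`, seat t3; bears_on W-C/W-P as the
§4 input "(A) `hTr`" of the apex chain (`MainInequalityAssembly.weilArchPositivity_soninTrace_fine_of_spectralData`).
WHAT THIS IS NOT: a statement about RH; positivity at the archimedean place never reaches the
critical strip.

A. Connes, C. Consani, *Weil positivity and trace formula, the archimedean place*, Selecta Math.
(N.S.) 27 (2021) 77 = arXiv:2006.13771 [bib: `ConnesConsani2021`], **§4 "Moving `Δ` inside `Σ`"**,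
arXiv running items 21–26 = Selecta **Lemma 4.1, Lemma 4.2, Definition 4.3, (Definition 4.4 =
`soninSpace`, already in the tree), Proposition 4.5, Remark 4.6** and the displays (complementproj),
(WLambdaq), (cosalpha), (prolateeq), (cosalphan), (cosalphan1), (rapid-decay) between them (arXiv text pp. 15–18; locators
`pNNNN:Lnn` = chunk:line of the held text `paper:arxiv-2006.13771`; every symbol below was checked
against the TeX source `cc/src/arXiv2006.13771-weil-compo.tex` ll. 880–1130, labels in parentheses).  Theorem 4.7 (item 27, the
archimedean trace formula `Tr(ϑ(f)𝐒) = W_∞(f) + ∫ f(ρ⁻¹)ε(ρ)d*ρ`) is typed by seat t4 over the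
vectors `ξ_n, ζ_n` defined here; §2 (`δ = traceRemainder`, `W_∞ = L − D`) is seat t1's LANDED
`SchwartzKernels.lean`, whose `traceRemainder`, `sinIntegral` and function-level `cutoffP` (CC's `P`) we
use, not restate.

## What is printed (symbol table)

* (eq. (40), p. 15, p0015:L38–L42) On `L²(ℝ)_ev`: `(ϑ(λ)ξ)(v) := λ^{-1/2} ξ(λ⁻¹ v)`; "the projection
  `P` … becomes the multiplication by the characteristic function of `{x ∈ ℝ | |x| ≥ 1}` and `P̂`
  becomes `𝔽_{e_ℝ}⁻¹ P 𝔽_{e_ℝ}`"; (complementproj), p0015:L43–L48: with the cutoff projections `𝒫_Λ`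
  (multiplication by `1_{[−Λ,Λ]}`) and `𝒫̂_Λ` of [Co-zeta] = Connes 1999 ([CMbook] Ch. 2 §3.3),
  `P = 1 − 𝒫₁`, `P̂ = 1 − 𝒫̂₁`.
* **Lemma 4.1** (= Lemma 21 (onequantum), p0015:L12): "For `ρ ≥ 1` one has (disponequa)
  `δ(ρ) = Tr(ϑ(ρ⁻¹)(1 − P̂)(1 − P))`",
  i.e. (1quantum), p0015:L51: `δ(ρ) = Tr(ϑ(ρ⁻¹) 𝒫̂₁ 𝒫₁)`, where `δ` is the trace-remainder of
  Definition 2.1 (= Def. 9, §2, p0010:L7; the tree's `traceRemainder`).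
* **Lemma 4.2** (= Lemma 22 (pairofproj), p0015:L56–L70; "the generalities on pairs of projections in Hilbert
  space follow from Lemma 2.3 of [CMbook]" = Connes–Marcolli 2008): "(i) Giving a pair of orthogonal
  projections `P_i`, `i = 1,2` on a Hilbert space `𝓗` is equivalent to giving a unitary representation
  of the dihedral group `Γ = ℤ/2 ∗ ℤ/2`.  These irreducible unitary representations are parameterized
  by an angle `α ∈ [0, π/2]`.  (ii) There exists a unique operator `α`, `0 ≤ α ≤ π/2`, commuting with
  `P_i`, such that (sinalpha) `sin(α) = |P₁ − P₂|`.  Moreover one has (cosalpha.0)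
  `P₁ P₂ P₁ = cos²(α) P₁`."
* **Definition 4.3** (= Def. 23, p0015:L72): "The operator `α` uniquely defined by (sinalpha) is called
  the angle operator between `P₁` and `P₂` and denoted `∠(P₁,P₂)`."
* (WLambdaq), p0016:L1–L12: "[Slepian–Pollak] there is a second-order differential operator `𝐖` on `ℝ`,
  which commutes with both `𝒫₁` and `𝒫̂₁`: `(𝐖ξ)(x) = −∂((1 − x²)∂)ξ(x) + (2πx)²ξ(x)`" (it commutes
  with `𝔽_{e_ℝ}`); (cosalpha), p0016:L13–L16: `𝒫₁𝒫̂₁𝒫₁ = cos²(α)𝒫₁`, `α = ∠(𝒫₁, 𝒫̂₁)`;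
  (prolateeq), p0016:L17–L21: with `PS_{2n,0}(2π, x)` the even prolate spheroidal wave functions of
  bandwidth `c = 2π`, `∫_{−1}^{1} PS_{2n,0}(2π, x) e^{i2πxω} dx = λ(n) PS_{2n,0}(2π, ω)`; p0016:L22–L25:
  "The eigenvalues `λ(n)` are the `λ_{2n}^c` (`c = 2π`) in the notations of [Wang].  They are given
  numerically by the list `λ(0) = 0.999971, λ(1) = −0.979485, λ(2) = 0.524086, λ(3) = −0.0589766,
  λ(4) = 0.00273233, λ(5) = −0.0000762914, …` and all the further ones decay very fast to `0`";
  (cosalphan), p0016:L25–L28: with `φ_n` the restriction of `PS_{2n,0}(2π,·)` to `[−1,1]` as an element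
  of `𝒫₁L²(ℝ)_ev`, `𝒫₁𝔽_{e_ℝ}𝒫₁φ_n = λ(n)𝒫₁φ_n`; (cosalphan1), p0016:L29–L32:
  `𝒫₁𝒫̂₁𝒫₁φ_n = λ(n)²𝒫₁φ_n`, hence (p0016:L33–L34) "the non-zero eigenvalues `α(n)` of `α` are
  given by `cos α(n) = |λ(n)|`.  The sequence `|λ(n)|` is of rapid decay, and one has more precisely the
  inequality (see [Rokhlin], Theorem 14, and Appendix E)" (rapid-decay), p0016:L34–L37:
  `|λ(n)| ≤ 2^{2n}π^{2n+1/2}((2n)!)² / ((4n)! Γ(2n+3/2)) ∼ (4n+1)^{−2n−1/2}(eπ)^{2n+1/2}` (the second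
  relation is an ASYMPTOTIC EQUIVALENCE `∼` in the source, not an inequality); p0016:L39: on Sonin's space
  `S(1,1)` "both `𝒫₁` and `𝒫̂₁` are `= 0` and thus by (sinalpha) one has `∠(𝒫₁,𝒫̂₁)|_{S(1,1)} = 0`".  Dirac notation `|ξ⟩⟨η|(ξ′) := ξ⟨η|ξ′⟩`, inner product antilinear
  in the first vector (p0016:L43–L48).
* **Proposition 4.5** (= Prop. 25 (devil0), p0016:L50–L64; proof p. 17).  "(i) Let
  `ξ_n = 𝒫₁φ_n/‖𝒫₁φ_n‖`, `η_n = 𝔽_{e_ℝ}ξ_n` and `ψ_n = Pη_n`.  One has (chirem0.5)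
  `𝒫₁η_n = 𝒫₁𝔽_{e_ℝ}ξ_n = λ(n)ξ_n`.  (ii) For `ρ ≥ 1`, (chirem1)
  `δ(ρ) = Tr(ϑ(ρ⁻¹)𝒫̂₁𝒫₁) = Σ_n (λ(n)²⟨ξ_n|ϑ(ρ⁻¹)ξ_n⟩ + λ(n)⟨ξ_n|ϑ(ρ⁻¹)ψ_n⟩)`.
  (iii) The functions `ψ_n = P𝔽_{e_ℝ}ξ_n` are real valued, pairwise orthogonal and `‖ψ_n‖ = √(1−λ(n)²)`,
  (smaller) `Σ λ(n)²|ζ_n⟩⟨ζ_n| ≤ P P̂ P`, `ζ_n := ψ_n/√(1−λ(n)²)`.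
  (iv) Let `τ(n) := λ(n)/√(1−λ(n)²)`, one has (hattrick)
  `⟨ξ_n|ϑ(ρ⁻¹)ξ_n⟩ = ⟨ζ_n|ϑ(ρ⁻¹)ζ_n⟩ + τ(n)(⟨ξ_n|ϑ(ρ⁻¹)ζ_n⟩ + ⟨ζ_n|ϑ(ρ⁻¹)ξ_n⟩)`."
  Inside the proof (p. 17): "The vectors `ξ_n` form an orthonormal basis of the range of `𝒫₁`" (in
  `L²(ℝ)_ev`; p0017:L2), (chirem1.5) `𝒫̂₁ξ_n = λ(n)η_n`, (chirem2) `𝒫̂₁𝒫₁ = Σ λ(n)|η_n⟩⟨ξ_n|`,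
  `η_n = ψ_n + λ(n)ξ_n`, (chirem3), `E_n := {ξ ∈ L²(ℝ)_ev : |𝒫₁ − 𝒫̂₁|ξ = √(1−λ(n)²) ξ}`
  (two-dimensional, `∋ ξ_n, η_n, ζ_n`), and (spectral), p0017:L59–L63: "`P P̂ P = Σ λ(n)²|ζ_n⟩⟨ζ_n| + R` where `R` …
  is the orthogonal projection on Sonin's space `S(1,1)`" — the input of Theorem 4.7's proof
  (sonine2), p0018:L77–L79.
* **Remark 4.6** (= Rem. 26 (sym), p0018:L1–L29).  "(i) Equality (chirem1) implies in particular that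
  `δ(1) = Σ λ(n)²`, `2(Si(4π)/(4π) + 1) = Σ λ(n)²`, and one checks numerically that both sides are
  `∼ 2.237484835` … `ψ_n(1) = 𝔽_{e_ℝ}ξ_n(1) = λ(n)ξ_n(1)` … (chirem1) implies `Σ λ(n)² ξ_n(1)² = 2`"
  (this last equality PROVED in print from `δ′(1⁺) = 1`, (sch18.5) of §2).  "(ii) … for `ρ ≥ 1` one
  has (sym1) `⟨ψ_n|ϑ(ρ⁻¹)ξ_n⟩ = 0`, `⟨ζ_n|ϑ(ρ⁻¹)ξ_n⟩ = 0` … Thus one can rewrite (chirem1) in a more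
  symmetric manner replacing the term `⟨ξ_n|ϑ(ρ⁻¹)ψ_n⟩` … with
  `⟨ξ_n|ϑ(ρ⁻¹)ψ_n⟩ + ⟨ψ_n|ϑ(ρ⁻¹)ξ_n⟩ = ⟨ξ_n|ϑ(ρ⁻¹)ψ_n⟩ + ⟨ξ_n|ϑ(ρ)ψ_n⟩`, which is invariant under
  `ρ ↦ ρ⁻¹` so that, after this replacement, (chirem1) is valid for all `ρ ∈ ℝ₊*`."

## How it is typed (design decisions; read before citing)

* **Hilbert space.**  As in `ArchimedeanSoninTrace`/`SoninProjection`/`SemilocalSoninSpace` we work on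
  all of `L²(ℝ) = Lp ℂ 2 volume` with Mathlib's inner product `∫_ℝ ξ̄ η` and keep evenness as the
  submodule `evenPart` (CC: `L²(ℝ)_ev` with `⟨ξ|η⟩ = ½∫_ℝ ξ̄η = ∫₀^∞ ξ̄η`, eq. (8) = (innerltwoeven)).
  For EVEN vectors the two normalisations give THE SAME inner products and norms of correspondingly
  normalised vectors (a CC-unit vector is `√2` times a Mathlib-unit vector and CC's inner product is half
  of Mathlib's), so every matrix coefficient `⟨ξ_n|ϑ(ρ⁻¹)ζ_n⟩`, `‖ψ_n‖`, `⟨ζ_n|ξ⟩` below is LITERALLY the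
  printed number; only POINTWISE VALUES differ: CC's `ξ_n(x) = √2 · prolateFun n x` (this matters in
  Remark 4.6 (i), `ψ_n(1) = λ(n)ξ_n(1)`, `Σ λ(n)² ξ_n(1)² = 2`, typed with the explicit `√2`, and for seat
  t5's Lemma 5.4 `ε′(1₊) = Σ λ(n)²ξ_n(1)²/(1−λ(n)²)` and the bound `|ξ_n(1)| ≤ √2·√(2n+½)`, cf. seat t6's
  located erratum 02:20:51Z).
* **Cutoff projections.**  `cutoffProj Λ` = `𝒫_Λ` = multiplication by `1_{[−Λ,Λ]}` as a bounded operator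
  on `L²(ℝ)` (the tree's `Literature.Analysis.OperatorTheory.indicatorLp`), `cutoffProjHat Λ = 𝒫̂_Λ =
  𝓕⁻¹ ∘ 𝒫_Λ ∘ 𝓕` with Mathlib's unitary `L²` Fourier transform (kernel `e^{−2πixy}` = CC's `𝔽_{e_ℝ}`,
  eq. (13)); `outerProj = 1 − 𝒫₁ = P`, `outerProjHat = 1 − 𝒫̂₁ = P̂` (eq. (complementproj)); the
  function-level `P` of the tree's `SchwartzKernels.cutoffP` (`v ↦ 1_{|v| ≥ 1}ξ(v)`) is `outerProj` a.e.
  (`outerProj_coeFn`, PROVED).  PROVED: `𝒫_Λ`, `𝒫̂_Λ` are star projections (orthogonal projections), and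
  Sonin's space is the joint kernel: `ξ ∈ S(α,β) ↔ ξ even ∧ 𝒫_α ξ = 0 ∧ 𝒫̂_β ξ = 0`.
* **Scaling.**  No operator `ϑ` is introduced here (the operators `ϑ(e^τ)`, `ϑ(f)` are seat O4a's
  `ScalingOperator.scalingUnitary/scalingOp`, with `scalingCoeff ξ η τ = ⟪ξ, ϑ(e^τ)η⟫`): every matrix
  coefficient is written with the tree's `ArchimedeanSoninTrace.scalingCoeff` as
  `repCoeff u v ρ := scalingCoeff u v (−log ρ) = ⟨u|ϑ(ρ⁻¹)v⟩ = ρ^{1/2}∫ ū(x) v(ρx) dx` on the canonical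
  function representatives of `ξ_n, η_n, ψ_n, ζ_n` (the form in which §5 and seat t4's `epsTerm` consume
  them: Lemma 5.2's `k(ρ) = ρ^{1/2}∫ ξ(x)ζ(ρx)dx`).
* **Angle operator** (general complex Hilbert space): `angleOp P₁ P₂ := arcsin|P₁ − P₂|` by Mathlib's
  continuous functional calculus `cfc` of the self-adjoint `P₁ − P₂` (Def. 4.3, `∠(P₁,P₂)`); Lemma 4.2
  (ii) is the named fact `CC2021_lem_4_2_ii` (all clauses, for this explicit `α`); Lemma 4.2 (i), first
  sentence, is the PROVED dictionary `isStarProjection_iff_reflection` (a pair of orthogonal projections =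
  a pair of self-adjoint unitaries `1 − 2P_i` = a unitary representation of `ℤ/2 ∗ ℤ/2` by the universal
  property of the free product, Mathlib `Monoid.Coprod.lift`: `dihedralRep`); second sentence = the named
  fact `CC2021_lem_4_2_i` (for an irreducible pair the angle operator is a scalar `α ∈ [0, π/2]`).
* **Prolate functions.**  NO second PSWF notion: `prolateFun n` is THE tree prolate function
  `h_{2n,1}` of `Literature.NumberTheory.LFunctions.IsProlateFunction 1 (2n)` (principal eigenfunction of
  `𝐖 = prolateOp 1` with `2n` zeros in `(−1,1)`, `∫_{−1}^{1} h² = 1`, `h(0) > 0`, extended by `0`;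
  `exists_isProlateFunction`, `IsProlateFunction.unique`), i.e. CC's `φ_n = PS_{2n,0}(2π,·)|_{[−1,1]}` up to
  a nonzero scalar, and CC's unit vector `ξ_n = ±√2·prolateFun n` pointwise (sign immaterial: every
  typed statement is invariant under `ξ_n ↦ −ξ_n`).  The eigenvalue `λ(n)` is DEFINED as
  `prolateEigen n := (∫ h)/h(0)`, i.e. (cosalphan) evaluated at `ω = 0` (`h(0) ≠ 0`) — literally seat t4's
  `ArchimedeanTraceFormula.prolateLambda (prolateFun n)` (same formula; `rfl` once both files are in the
  tree); that this number is the eigenvalue at every `ω ∈ [−1,1]` — the Slepian–Pollak "commuting miracle"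
  (WLambdaq), (prolateeq), (cosalphan): the eigenfunctions of `𝐖` are the eigenfunctions of the finite
  Fourier transform — is the named fact `CC2021_sec4_cosalphan` (Rokhlin–Xiao 2007 Thm. 4 ← Slepian–Pollak
  1961), and sign `(−1)^n` / `|λ(n)| < 1` / strict decrease / `→ 0` is `CC2021_sec4_lambda_basic`
  (Rokhlin–Xiao 2007 Thm. 3; Connes 2026 Letter Fact 6.3 at `λ = 1`: `ν_n(1) = λ(n)²`, `χ_n = λ(n)`).
  Orthonormality / completeness of `(ξ_n)` in `𝒫₁L²(ℝ)_ev` are `CC2021_sec4_xi_orthonormal` /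
  `CC2021_sec4_xi_complete` (Rokhlin–Xiao Thm. 3, "orthonormal and complete in `L²[−1,1]`").  The
  commutation `[𝐖, 𝒫₁] = [𝐖, 𝒫̂₁] = 0` itself (unbounded operator) is not typed as a formula; its printed
  USE is (cosalphan).
* **Vectors.**  Function level (canonical representatives, the form used by §5/App. E and by seat t4):
  `prolateXiFun n = ξ_n`, `prolateEtaFun n = η_n = 𝓕 ξ_n` (Fourier INTEGRAL), `prolatePsiFun n = ψ_n =
  SchwartzKernels.cutoffP η_n` (`= ArchimedeanTraceFormula.prolateCutFourier (prolateFun n)`, same formula),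
  `prolateZetaFun n = ζ_n = ψ_n/√(1−λ(n)²)`, `prolateTau n = τ(n)`; `L²` level: `prolateXi n` (the class of
  `ξ_n`), `prolateEta n = 𝓕(prolateXi n)` (Mathlib's `L²` transform; a.e. `= prolateEtaFun n`, PROVED via the
  tree's `FourierNS.fourier_toLp_ae_eq`), `prolatePsi n = P η_n`, `prolateZeta n`, with `coeFn` lemmas.
* **Traces.**  Mathlib has no trace class.  Lemma 4.1 / Prop. 4.5 (ii) concern `Tr(ϑ(ρ⁻¹)𝒫̂₁𝒫₁)` on
  `L²(ℝ)_ev`, and `δ` is the tree's `traceRemainder` (Def. 2.1 recast by its closed form (25),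
  `SchwartzKernels`).  We type the trace as the printed proof computes it (first display of the proof of
  Prop. 4.5 (ii), p0017:L4): the ORTHONORMAL-BASIS SUM `Σ_n ⟨ξ_n|ϑ(ρ⁻¹)𝒫̂₁𝒫₁ξ_n⟩` over the basis `(ξ_n)`
  of `𝒫₁L²(ℝ)_ev` (the operator kills `(1 − 𝒫₁)L²`), so Lemma 4.1 reads
  "`Σ_n ⟨ξ_n|ϑ(ρ⁻¹)𝒫̂₁𝒫₁ξ_n⟩ = δ(ρ)`" (`CC2021_lem_4_1`) and Prop. 4.5 (ii) is (chirem1) verbatim with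
  `δ = traceRemainder`.  Operator identities "`A = Σ |u_n⟩⟨v_n|`" are typed vector-wise as `HasSum`
  statements on `evenPart`; the operator inequality (smaller) `Σ λ(n)²|ζ_n⟩⟨ζ_n| ≤ PP̂P` as
  `Σ_{n∈s} λ(n)²|⟨ζ_n|ξ⟩|² ≤ ⟨ξ|PP̂Pξ⟩ = ‖P̂Pξ‖²` on finite partial sums (the quadratic-form reading seat
  O4a's `HilbertSchmidtPartialSums` consumes).
* **Floating point.**  The printed six-digit values of `λ(0..5)` and the check "`∼ 2.237484835`" are
  NUMERICAL-IN-PRINT facts (`CC2021_sec4_lambda_numerics`, `CC2021_rem_4_6_i_numerics`), typed as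
  one-unit-in-the-last-printed-digit enclosures, labelled, never theorems here (charter rule 5: 0 kit).
* **(rapid-decay).**  Typed AS PRINTED for all `n` (`CC2021_sec4_rapidDecay`): the inequality
  `|λ(n)| ≤ RX(n)` with `RX(n) = 2^{2n}π^{2n+1/2}((2n)!)²/((4n)!Γ(2n+3/2)) = √π(2π)^{2n}((2n)!)²/((4n)!Γ(2n+3/2))`
  and the asymptotic equivalence `RX(n) ∼ (4n+1)^{−2n−1/2}(eπ)^{2n+1/2}` (Mathlib `Asymptotics.IsEquivalent`,
  a Stirling computation — PROVED in the tree: `isEquivalent_rokhlinXiaoBound`).  SOURCE STATUS RECORDED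
  (cc ruling R64, first-hand reading of Rokhlin–Xiao 2007): Thm. 9 ((57)–(58), p. 114) is proved; Thm. 14
  (p. 117, `m` sufficiently large, `c` fixed) is derived from it through the UNPROVED computer-algebra
  expansion (67) — CONJECTURE-CLASS in print; CC state it at `c = 2π`, `m = 2n`, for all `n` and use it
  (App. E, proof of Lemma E.1 = Lemma 49, p0035:L87) for `n ≥ 3`.  Proved-in-print substitute for the
  decay input: Osipov 2013 Thm. 33 (`Osipov2013_thm_33`, module `LFunctions.ProlateEigenvalueDecay`).
  Checked here against the printed `λ(n)`: for `n = 0..5` the bound is `2, 3.51, 0.754, 0.0631,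
  2.80·10⁻³, 7.73·10⁻⁵` versus `|λ(n)| = 1.00, 0.979, 0.524, 0.0590, 2.73·10⁻³, 7.63·10⁻⁵` (margins
  `1.07, 1.026, 1.013` at `n = 3, 4, 5`).

## Deliberately NOT here

Theorem 4.7 and `ε` (seat t4), §2 (seat t1, landed: cited), §5 (`E`, Lemma 5.1–5.4; seats t5/t6), the
operators `ϑ(λ)`, `ϑ(f)` (seat O4a), the two-dimensional eigenspaces `E_n` of the proof of Prop. 4.5
(iii) (proof-internal bookkeeping), any numerics beyond the printed digits, and anything about `ζ` or RH.
-/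

noncomputable section

universe u

open _root_.MeasureTheory Complex Set FourierTransform Filter
open scoped Real ComplexConjugate InnerProductSpace ENNReal Topology

namespace Literature.NumberTheory.ConnesConsani2021

open Literature.NumberTheory.LFunctions Literature.Analysis.OperatorTheory

/-! ## Lemma 4.2 (i)–(ii), Definition 4.3: pairs of projections and the angle operator (general Hilbert space) -/

section PairsOfProjections

variable {H : Type*} [NormedAddCommGroup H] [InnerProductSpace ℂ H] [CompleteSpace H]

/-- The reflection `u = 1 − 2P` attached to an operator `P` (for an orthogonal projection `P`, the
self-adjoint unitary generating the copy of `ℤ/2` in Lemma 4.2 (i)). [cite: ConnesConsani2021, Lemma 4.2 (i) §4 p. 15 (arXiv item Lemma 22, p0015:L56–L62)] -/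
def reflection (P : H →L[ℂ] H) : H →L[ℂ] H := 1 - 2 • P

/-- **Lemma 4.2 (i), first sentence, as a dictionary (PROVED)**: `P` is an orthogonal projection
(`IsStarProjection`: self-adjoint idempotent) iff `u = 1 − 2P` is a self-adjoint unitary, i.e. a unitary
involution — so a PAIR of orthogonal projections is the same as a pair of unitary involutions, which by
the universal property of the free product (Mathlib `Monoid.Coprod.lift`) is the same as a unitary
representation of the infinite dihedral group `Γ = ℤ/2 ∗ ℤ/2` ("Giving a pair of orthogonal projections
`P_i` … is equivalent to giving a unitary representation of the dihedral group").
[cite: ConnesConsani2021, Lemma 4.2 (i) §4 p. 15 (arXiv item Lemma 22, p0015:L56–L62); ConnesMarcolli2008, Ch. 2 §3.3 Lemma 2.3] -/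
theorem isStarProjection_iff_reflection (P : H →L[ℂ] H) :
    IsStarProjection P ↔ (reflection P ∈ unitary (H →L[ℂ] H) ∧ IsSelfAdjoint (reflection P)) := by
  have hsq : ∀ Q : H →L[ℂ] H, reflection Q * reflection Q = 1 - 4 • (Q - Q * Q) := fun Q => by
    simp only [reflection]
    noncomm_ring
  have hstarQ : ∀ Q : H →L[ℂ] H, star (reflection Q) = reflection (star Q) := fun Q => by
    simp only [reflection, star_sub, star_one, star_nsmul]
  constructor
  · intro hP
    have hstar : star (reflection P) = reflection P := by
      rw [hstarQ, hP.isSelfAdjoint.star_eq]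
    have hmul : reflection P * reflection P = 1 := by
      rw [hsq, hP.isIdempotentElem.eq, sub_self, smul_zero, sub_zero]
    refine ⟨?_, hstar⟩
    rw [Unitary.mem_iff, hstar]
    exact ⟨hmul, hmul⟩
  · rintro ⟨hu, hsa⟩
    have hstar : star (reflection P) = reflection P := hsa.star_eq
    have hmul : reflection P * reflection P = 1 := by
      have := Unitary.star_mul_self_of_mem hu
      rwa [hstar] at this
    have hidem : P * P = P := by
      have h4 : (4 • (P - P * P) : H →L[ℂ] H) = 0 := sub_eq_self.mp ((hsq P).symm.trans hmul)
      have h4' : ((4 : ℕ) : ℂ) • (P - P * P) = 0 := by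
        rw [Nat.cast_smul_eq_nsmul]; exact h4
      rcases smul_eq_zero.mp h4' with h | h
      · norm_num at h
      · exact (sub_eq_zero.mp h).symm
    have hself : star P = P := by
      have h := hstar
      rw [hstarQ] at h
      simp only [reflection] at h
      have h2 : (2 • star P : H →L[ℂ] H) = 2 • P := sub_right_injective h
      have h2' : ((2 : ℕ) : ℂ) • star P = ((2 : ℕ) : ℂ) • P := by
        rw [Nat.cast_smul_eq_nsmul, Nat.cast_smul_eq_nsmul]; exact h2
      exact smul_right_injective (H →L[ℂ] H) (by norm_num : ((2 : ℕ) : ℂ) ≠ 0) h2'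
    exact ⟨hidem, hself⟩

omit [CompleteSpace H] in
/-- `(1 − 2P)² = 1` for an idempotent `P`. [cite: ConnesConsani2021, Lemma 4.2 (i) §4 p. 15 (arXiv item Lemma 22, p0015:L56–L62)] -/
theorem reflection_mul_self {P : H →L[ℂ] H} (hP : IsIdempotentElem P) :
    reflection P * reflection P = 1 := by
  have hsq : reflection P * reflection P = 1 - 4 • (P - P * P) := by
    simp only [reflection]
    noncomm_ring
  rw [hsq, hP.eq, sub_self, smul_zero, sub_zero]

/-- A unitary involution `u` (`u² = 1`) defines a monoid hom from `ℤ/2` (written multiplicatively).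
[folklore] -/
def involutionHom {G : Type*} [Monoid G] (u : G) (hu : u * u = 1) : Multiplicative (ZMod 2) →* G where
  toFun x := if x = 1 then 1 else u
  map_one' := by simp
  map_mul' a b := by
    have key : ∀ z : Multiplicative (ZMod 2), z = 1 ∨ z = Multiplicative.ofAdd 1 := by decide
    have h11 : (Multiplicative.ofAdd (1 : ZMod 2)) * Multiplicative.ofAdd (1 : ZMod 2) = 1 := by decide
    have hne : (Multiplicative.ofAdd (1 : ZMod 2)) ≠ 1 := by decide
    rcases key a with rfl | rfl <;> rcases key b with rfl | rfl <;> simp [h11, hne, hu]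

/-- **Lemma 4.2 (i), the representation**: the unitary representation of `Γ = ℤ/2 ∗ ℤ/2` attached to a
pair of orthogonal projections, `g_i ↦ 1 − 2P_i` (Mathlib's free product `Monoid.Coprod` and its
universal property `Coprod.lift`). [cite: ConnesConsani2021, Lemma 4.2 (i) §4 p. 15 (arXiv item Lemma 22, p0015:L56–L62)] -/
def dihedralRep (P₁ P₂ : H →L[ℂ] H) (h₁ : IsStarProjection P₁) (h₂ : IsStarProjection P₂) :
    Monoid.Coprod (Multiplicative (ZMod 2)) (Multiplicative (ZMod 2)) →* unitary (H →L[ℂ] H) :=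
  Monoid.Coprod.lift
    (involutionHom (⟨reflection P₁, ((isStarProjection_iff_reflection P₁).1 h₁).1⟩ : unitary (H →L[ℂ] H))
      (Subtype.ext (by
        change reflection P₁ * reflection P₁ = 1
        exact reflection_mul_self h₁.isIdempotentElem)))
    (involutionHom (⟨reflection P₂, ((isStarProjection_iff_reflection P₂).1 h₂).1⟩ : unitary (H →L[ℂ] H))
      (Subtype.ext (by
        change reflection P₂ * reflection P₂ = 1
        exact reflection_mul_self h₂.isIdempotentElem)))

/-- The representation sends the two generators to the reflections `1 − 2P₁`, `1 − 2P₂`.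
[cite: ConnesConsani2021, Lemma 4.2 (i) §4 p. 15 (arXiv item Lemma 22, p0015:L56–L62)] -/
theorem dihedralRep_inl_inr (P₁ P₂ : H →L[ℂ] H) (h₁ : IsStarProjection P₁) (h₂ : IsStarProjection P₂) :
    (dihedralRep P₁ P₂ h₁ h₂ (Monoid.Coprod.inl (Multiplicative.ofAdd 1)) : H →L[ℂ] H) = reflection P₁ ∧
    (dihedralRep P₁ P₂ h₁ h₂ (Monoid.Coprod.inr (Multiplicative.ofAdd 1)) : H →L[ℂ] H) = reflection P₂ := by
  have hne : (Multiplicative.ofAdd (1 : ZMod 2)) ≠ 1 := by decide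
  constructor
  · simp [dihedralRep, involutionHom, hne]
  · simp [dihedralRep, involutionHom, hne]

/-- The operator `|P₁ − P₂|` of (sinalpha), by the continuous functional calculus of the self-adjoint
`P₁ − P₂`. [cite: ConnesConsani2021, Lemma 4.2 (ii) §4 p. 15 (arXiv item Lemma 22, p0015:L63–L66)] -/
def absDiff (P₁ P₂ : H →L[ℂ] H) : H →L[ℂ] H := cfc (fun x : ℝ => |x|) (P₁ - P₂)

/-- **Definition 4.3, the angle operator `∡(P₁, P₂)`**: the operator `α = arcsin |P₁ − P₂|`
(continuous functional calculus of the self-adjoint contraction `P₁ − P₂`), which for a pair of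
orthogonal projections is the unique `0 ≤ α ≤ π/2` commuting with `P₁, P₂` with `sin α = |P₁ − P₂|`
(Lemma 4.2 (ii), typed as `CC2021_lem_4_2_ii`).  In the irreducible two-dimensional representation of
angle `θ` (`P₁ = e₁₁`, `P₂` = projection on `(cos θ, sin θ)`), `(P₁ − P₂)² = sin²θ` and `P₁P₂P₁ = cos²θ P₁`.
[cite: ConnesConsani2021, Def. 4.3 §4 p. 15 (arXiv item Definition 23, p0015:L72–L73)] -/
def angleOp (P₁ P₂ : H →L[ℂ] H) : H →L[ℂ] H := cfc (fun x : ℝ => Real.arcsin |x|) (P₁ - P₂)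

/-- A pair of operators is IRREDUCIBLE when the space is nonzero and the only closed subspaces
invariant under both are `0` and the whole space (irreducibility of the associated unitary
representation of `ℤ/2 ∗ ℤ/2`, Lemma 4.2 (i)). [cite: ConnesConsani2021, Lemma 4.2 (i) §4 p. 15 (arXiv item Lemma 22, p0015:L57–L62)] -/
def IsIrreduciblePair (P₁ P₂ : H →L[ℂ] H) : Prop :=
  Nontrivial H ∧ ∀ K : Submodule ℂ H, IsClosed (K : Set H) →
    (∀ x ∈ K, P₁ x ∈ K) → (∀ x ∈ K, P₂ x ∈ K) → (K = ⊥ ∨ K = ⊤)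

end PairsOfProjections

/-- **Lemma 4.2 (i), second sentence (NAMED FACT, no proof claimed here)**: "These irreducible unitary
representations [of `ℤ/2 ∗ ℤ/2`, i.e. irreducible pairs of orthogonal projections] are parameterized by
an angle `α ∈ [0, π/2]`" — typed as: for an irreducible pair the angle operator of Definition 4.3 is a
scalar `α ∈ [0, π/2]` (it commutes with `P₁, P₂`, hence with the irreducible pair, hence is scalar; the
classification up to unitary equivalence — the four characters `α ∈ {0, π/2}` and the two-dimensional
`π_α`, `0 < α < π/2` — is not typed).  RH-FREE (Hilbert-space geometry).
[cite: ConnesConsani2021, Lemma 4.2 (i) §4 p. 15 (arXiv item Lemma 22, p0015:L57–L62); ConnesMarcolli2008, Ch. 2 §3.3 Lemma 2.3] -/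
def CC2021_lem_4_2_i : Prop :=
  ∀ (H : Type u) [NormedAddCommGroup H] [InnerProductSpace ℂ H] [CompleteSpace H]
    (P₁ P₂ : H →L[ℂ] H), IsStarProjection P₁ → IsStarProjection P₂ → IsIrreduciblePair P₁ P₂ →
      ∃ α ∈ Icc (0 : ℝ) (π / 2), angleOp P₁ P₂ = (α : ℂ) • (1 : H →L[ℂ] H)

/-- **Lemma 4.2 (ii) (NAMED FACT, no proof claimed here; a continuous-functional-calculus exercise left
for the discharge pass)**.  As printed: "There exists a unique operator `α`, `0 ≤ α ≤ π/2`, commuting with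
`P_i`, `i = 1,2` such that `sin(α) = |P₁ − P₂|`.  Moreover one has `P₁P₂P₁ = cos²(α)P₁`."  Typed for the
explicit `α = angleOp P₁ P₂ = arcsin|P₁ − P₂|`: it is self-adjoint with spectrum in `[0, π/2]`, commutes
with `P₁` and `P₂`, satisfies `sin α = |P₁ − P₂|` and `P₁P₂P₁ = cos²(α)P₁`, and any self-adjoint `β` with
spectrum in `[0, π/2]` and `sin β = |P₁ − P₂|` equals `α`.  RH-FREE.
[cite: ConnesConsani2021, Lemma 4.2 (ii) §4 p. 15 (arXiv item Lemma 22, p0015:L63–L70); ConnesMarcolli2008, Ch. 2 §3.3 Lemma 2.3] -/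
def CC2021_lem_4_2_ii : Prop :=
  ∀ (H : Type u) [NormedAddCommGroup H] [InnerProductSpace ℂ H] [CompleteSpace H]
    (P₁ P₂ : H →L[ℂ] H), IsStarProjection P₁ → IsStarProjection P₂ →
      IsSelfAdjoint (angleOp P₁ P₂) ∧ spectrum ℝ (angleOp P₁ P₂) ⊆ Icc 0 (π / 2) ∧
      Commute (angleOp P₁ P₂) P₁ ∧ Commute (angleOp P₁ P₂) P₂ ∧
      cfc Real.sin (angleOp P₁ P₂) = absDiff P₁ P₂ ∧
      P₁ * P₂ * P₁ = cfc Real.cos (angleOp P₁ P₂) ^ 2 * P₁ ∧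
      (∀ β : H →L[ℂ] H, IsSelfAdjoint β → spectrum ℝ β ⊆ Icc 0 (π / 2) →
        cfc Real.sin β = absDiff P₁ P₂ → β = angleOp P₁ P₂)

/-! ## The cutoff projections `𝒫_Λ`, `𝒫̂_Λ` on `L²(ℝ)` and CC's `P = 1 − 𝒫₁`, `P̂ = 1 − 𝒫̂₁` (eq. (complementproj)) -/

section Cutoff

/-- **The cutoff projection `𝒫_Λ`**: multiplication by the characteristic function `1_{[−Λ, Λ]}` on
`L²(ℝ)` ([Co-zeta] = Connes 1999; CC 2021 §4 p. 15, "the pair `𝒫_Λ` and `𝒫̂_Λ` associated to the cutoff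
parameter `Λ`", `P = 1 − 𝒫₁`), as a bounded operator: the tree's `indicatorLp`.  RH-FREE.
[cite: ConnesConsani2021, §4 p. 15 eq. (complementproj) (arXiv p0015:L36–L48)] -/
def cutoffProj (Λ : ℝ) : Lp ℂ 2 (volume : Measure ℝ) →L[ℂ] Lp ℂ 2 (volume : Measure ℝ) :=
  indicatorLp (volume : Measure ℝ) 2 (measurableSet_Icc : MeasurableSet (Icc (-Λ) Λ))

/-- `𝒫_Λ ξ = 1_{[−Λ,Λ]} ξ` almost everywhere. [cite: ConnesConsani2021, §4 p. 15 eq. (complementproj) (arXiv p0015:L42–L48)] -/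
theorem cutoffProj_coeFn (Λ : ℝ) (ξ : Lp ℂ 2 (volume : Measure ℝ)) :
    (cutoffProj Λ ξ : ℝ → ℂ) =ᵐ[volume] (Icc (-Λ) Λ).indicator (ξ : ℝ → ℂ) :=
  indicatorLp_coeFn _ ξ

/-- **The dual cutoff projection `𝒫̂_Λ := 𝔽_{e_ℝ}⁻¹ 𝒫_Λ 𝔽_{e_ℝ}`** on `L²(ℝ)` (Mathlib's unitary `L²`
Fourier transform, kernel `e^{−2πixy}` = CC's eq. (13)); "`P̂` becomes `𝔽_{e_ℝ}⁻¹ P 𝔽_{e_ℝ}`",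
`P̂ = 1 − 𝒫̂₁`.  RH-FREE. [cite: ConnesConsani2021, §4 p. 15 eq. (complementproj) (arXiv p0015:L42–L48)] -/
def cutoffProjHat (Λ : ℝ) : Lp ℂ 2 (volume : Measure ℝ) →L[ℂ] Lp ℂ 2 (volume : Measure ℝ) :=
  (((Lp.fourierTransformₗᵢ ℝ ℂ).symm.toContinuousLinearEquiv :
      Lp ℂ 2 (volume : Measure ℝ) →L[ℂ] Lp ℂ 2 (volume : Measure ℝ)).comp (cutoffProj Λ)).comp
    ((Lp.fourierTransformₗᵢ ℝ ℂ).toContinuousLinearEquiv :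
      Lp ℂ 2 (volume : Measure ℝ) →L[ℂ] Lp ℂ 2 (volume : Measure ℝ))

/-- `𝒫̂_Λ ξ = 𝓕⁻¹ (𝒫_Λ (𝓕 ξ))` (unfolding). [cite: ConnesConsani2021, §4 p. 15 eq. (complementproj) (arXiv p0015:L42–L48)] -/
theorem cutoffProjHat_apply (Λ : ℝ) (ξ : Lp ℂ 2 (volume : Measure ℝ)) :
    cutoffProjHat Λ ξ =
      (𝓕⁻ (cutoffProj Λ (𝓕 ξ : Lp ℂ 2 (volume : Measure ℝ))) : Lp ℂ 2 (volume : Measure ℝ)) :=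
  rfl

/-- CC's `P = 1 − 𝒫₁`: multiplication by `1_{|x| ≥ 1}` in the `L²(ℝ)_ev` picture (eq. (complementproj)),
as a bounded operator; a.e. the tree's function-level `SchwartzKernels.cutoffP` (`outerProj_coeFn`).
RH-FREE. [cite: ConnesConsani2021, §4 p. 15 eq. (complementproj) (arXiv p0015:L42–L48)] -/
def outerProj : Lp ℂ 2 (volume : Measure ℝ) →L[ℂ] Lp ℂ 2 (volume : Measure ℝ) := 1 - cutoffProj 1

/-- CC's `P̂ = 1 − 𝒫̂₁ = 𝔽_{e_ℝ}⁻¹ P 𝔽_{e_ℝ}` (eq. (complementproj)).  RH-FREE.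
[cite: ConnesConsani2021, §4 p. 15 eq. (complementproj) (arXiv p0015:L42–L48)] -/
def outerProjHat : Lp ℂ 2 (volume : Measure ℝ) →L[ℂ] Lp ℂ 2 (volume : Measure ℝ) := 1 - cutoffProjHat 1

/-- `P ξ = ξ − 𝒫₁ ξ` (unfolding). [cite: ConnesConsani2021, §4 p. 15 eq. (complementproj) (arXiv p0015:L42–L48)] -/
theorem outerProj_apply (ξ : Lp ℂ 2 (volume : Measure ℝ)) : outerProj ξ = ξ - cutoffProj 1 ξ := rfl

/-- `P̂ ξ = ξ − 𝒫̂₁ ξ` (unfolding). [cite: ConnesConsani2021, §4 p. 15 eq. (complementproj) (arXiv p0015:L42–L48)] -/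
theorem outerProjHat_apply (ξ : Lp ℂ 2 (volume : Measure ℝ)) : outerProjHat ξ = ξ - cutoffProjHat 1 ξ :=
  rfl

/-- **Dictionary with `SchwartzKernels.cutoffP`**: the operator `P = 1 − 𝒫₁` acts a.e. as the tree's
function-level `P`, `v ↦ 1_{|v| ≥ 1} ξ(v)` (the two differ only on the null set `{±1}`).  PROVED.
[cite: ConnesConsani2021, §4 p. 15 eq. (complementproj) (arXiv p0015:L42–L48)] -/
theorem outerProj_coeFn (ξ : Lp ℂ 2 (volume : Measure ℝ)) :
    (outerProj ξ : ℝ → ℂ) =ᵐ[volume] cutoffP (ξ : ℝ → ℂ) := by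
  have hnull : ∀ᵐ x : ℝ ∂(volume : Measure ℝ), x ∉ ({-1, 1} : Set ℝ) :=
    compl_mem_ae_iff.mpr ((Set.toFinite _).measure_zero volume)
  rw [outerProj_apply]
  filter_upwards [Lp.coeFn_sub ξ (cutoffProj 1 ξ), cutoffProj_coeFn 1 ξ, hnull] with x h1 h2 h3
  rw [h1, Pi.sub_apply, h2, cutoffP]
  simp only [mem_insert_iff, mem_singleton_iff, not_or] at h3
  by_cases hx : x ∈ Icc (-1 : ℝ) 1
  · have hlt : |x| < 1 := by
      rcases hx with ⟨h₁, h₂⟩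
      exact abs_lt.2 ⟨lt_of_le_of_ne h₁ (Ne.symm h3.1), lt_of_le_of_ne h₂ h3.2⟩
    rw [indicator_of_mem hx, if_neg (not_le.2 hlt), sub_self]
  · have hge : 1 ≤ |x| := by
      rw [mem_Icc, not_and_or, not_le, not_le] at hx
      rcases hx with h | h
      · rw [abs_of_neg (by linarith)]; linarith
      · rw [abs_of_pos (by linarith)]; exact h.le
    rw [indicator_of_notMem hx, if_pos hge, sub_zero]

/-- `𝒫_Λ` is idempotent (`1_A · 1_A = 1_A`). [cite: ConnesConsani2021, §4 p. 15 eq. (complementproj) (arXiv p0015:L42–L48)] -/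
theorem cutoffProj_idem (Λ : ℝ) : IsIdempotentElem (cutoffProj Λ) := by
  rw [IsIdempotentElem, ContinuousLinearMap.ext_iff]
  intro ξ
  rw [mul_apply_eq_comp]
  apply Lp.ext
  filter_upwards [cutoffProj_coeFn Λ (cutoffProj Λ ξ), cutoffProj_coeFn Λ ξ] with x h1 h2
  rw [h1]
  by_cases hx : x ∈ Icc (-Λ) Λ
  · rw [indicator_of_mem hx]
  · rw [indicator_of_notMem hx, h2, indicator_of_notMem hx]

/-- `𝒫_Λ` is self-adjoint (`⟪1_A ξ, η⟫ = ∫_A ξ̄η = ⟪ξ, 1_A η⟫`). [cite: ConnesConsani2021, §4 p. 15 eq. (complementproj) (arXiv p0015:L42–L48)] -/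
theorem cutoffProj_isSelfAdjoint (Λ : ℝ) : IsSelfAdjoint (cutoffProj Λ) := by
  rw [ContinuousLinearMap.isSelfAdjoint_iff_isSymmetric]
  intro ξ η
  change ⟪cutoffProj Λ ξ, η⟫_ℂ = ⟪ξ, cutoffProj Λ η⟫_ℂ
  rw [L2.inner_def, L2.inner_def]
  refine integral_congr_ae ?_
  filter_upwards [cutoffProj_coeFn Λ ξ, cutoffProj_coeFn Λ η] with x h1 h2
  rw [h1, h2]
  by_cases hx : x ∈ Icc (-Λ) Λ
  · rw [indicator_of_mem hx, indicator_of_mem hx]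
  · rw [indicator_of_notMem hx, indicator_of_notMem hx, inner_zero_left, inner_zero_right]

/-- **`𝒫_Λ` is an orthogonal projection** (a star projection in `𝓛(L²(ℝ))`).  PROVED.
[cite: ConnesConsani2021, §4 p. 15 eq. (complementproj) (arXiv p0015:L42–L48)] -/
theorem isStarProjection_cutoffProj (Λ : ℝ) : IsStarProjection (cutoffProj Λ) :=
  ⟨cutoffProj_idem Λ, cutoffProj_isSelfAdjoint Λ⟩

/-- **`𝒫̂_Λ` is an orthogonal projection** (the conjugate of `𝒫_Λ` by the unitary `𝓕`).  PROVED.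
[cite: ConnesConsani2021, §4 p. 15 eq. (complementproj) (arXiv p0015:L42–L48)] -/
theorem isStarProjection_cutoffProjHat (Λ : ℝ) : IsStarProjection (cutoffProjHat Λ) := by
  refine ⟨?_, ?_⟩
  · rw [IsIdempotentElem, ContinuousLinearMap.ext_iff]
    intro ξ
    have hP : cutoffProj Λ (cutoffProj Λ (𝓕 ξ : Lp ℂ 2 (volume : Measure ℝ))) =
        cutoffProj Λ (𝓕 ξ : Lp ℂ 2 (volume : Measure ℝ)) := by
      have h := congrFun (congrArg DFunLike.coe (cutoffProj_idem Λ).eq) (𝓕 ξ : Lp ℂ 2 (volume : Measure ℝ))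
      rwa [mul_apply_eq_comp] at h
    rw [mul_apply_eq_comp, cutoffProjHat_apply, cutoffProjHat_apply, fourier_fourierInv_eq, hP]
  · rw [ContinuousLinearMap.isSelfAdjoint_iff_isSymmetric]
    intro ξ η
    change ⟪cutoffProjHat Λ ξ, η⟫_ℂ = ⟪ξ, cutoffProjHat Λ η⟫_ℂ
    have hsym := ContinuousLinearMap.isSelfAdjoint_iff_isSymmetric.mp (cutoffProj_isSelfAdjoint Λ)
    rw [cutoffProjHat_apply, cutoffProjHat_apply,
      ← Lp.inner_fourier_eq (𝓕⁻ (cutoffProj Λ (𝓕 ξ : Lp ℂ 2 (volume : Measure ℝ))) :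
        Lp ℂ 2 (volume : Measure ℝ)) η,
      fourier_fourierInv_eq,
      ← Lp.inner_fourier_eq ξ (𝓕⁻ (cutoffProj Λ (𝓕 η : Lp ℂ 2 (volume : Measure ℝ))) :
        Lp ℂ 2 (volume : Measure ℝ)),
      fourier_fourierInv_eq]
    exact hsym _ _

/-- **Sonin's space is the joint kernel of the two cutoffs** ("on this subspace, which is Sonin's space
`S(1,1)` … both `𝒫₁` and `𝒫̂₁` are `= 0`", p. 16): `ξ ∈ S(α, β)` iff `ξ` is even, `𝒫_α ξ = 0` and
`𝒫̂_β ξ = 0`.  PROVED (Definition 4.4 unfolded). [cite: ConnesConsani2021, §4 p. 16 (arXiv p0016:L39); Def. 4.4 §4 p. 16] -/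
theorem mem_soninSpace_iff_cutoffProj {α β : ℝ} {ξ : Lp ℂ 2 (volume : Measure ℝ)} :
    ξ ∈ soninSpace α β ↔ ξ ∈ evenPart ∧ cutoffProj α ξ = 0 ∧ cutoffProjHat β ξ = 0 := by
  have key : ∀ (γ : ℝ) (η : Lp ℂ 2 (volume : Measure ℝ)),
      cutoffProj γ η = 0 ↔ ∀ᵐ x : ℝ, x ∈ Icc (-γ) γ → (η : ℝ → ℂ) x = 0 := by
    intro γ η
    constructor
    · intro h
      have h0 : (cutoffProj γ η : ℝ → ℂ) =ᵐ[volume] 0 := by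
        rw [h]; exact Lp.coeFn_zero ℂ 2 volume
      filter_upwards [h0, cutoffProj_coeFn γ η] with x hx hx' hxI
      rw [hx', indicator_of_mem hxI] at hx
      exact hx
    · intro h
      apply Lp.ext
      filter_upwards [cutoffProj_coeFn γ η, h, Lp.coeFn_zero ℂ 2 (volume : Measure ℝ)] with x hx h' h0
      rw [hx, h0]
      by_cases hxI : x ∈ Icc (-γ) γ
      · rw [indicator_of_mem hxI, h' hxI]; rfl
      · rw [indicator_of_notMem hxI]; rfl
  have keyhat : cutoffProjHat β ξ = 0 ↔ cutoffProj β (𝓕 ξ : Lp ℂ 2 (volume : Measure ℝ)) = 0 := by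
    rw [cutoffProjHat_apply]
    constructor
    · intro h
      have h1 := congrArg (fun ζ : Lp ℂ 2 (volume : Measure ℝ) => (𝓕 ζ : Lp ℂ 2 (volume : Measure ℝ))) h
      simp only [fourier_fourierInv_eq] at h1
      rw [h1]
      exact fourier_zero
    · intro h
      rw [h]
      exact fourierInv_zero
  rw [mem_soninSpace_iff', mem_vanishOn_iff, mem_vanishOn_iff, key, keyhat, key]

end Cutoff

/-! ## Matrix coefficients `⟨u|ϑ(ρ⁻¹)v⟩` of the scaling action (eq. (40)), through `scalingCoeff` -/

section Coeff

/-- **The matrix coefficient `⟨u|ϑ(ρ⁻¹)v⟩`** of the scaling action `(ϑ(λ)ξ)(v) = λ^{−1/2}ξ(λ⁻¹v)`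
(eq. (40), p. 15) at `λ = ρ⁻¹`, i.e. `ρ^{1/2}∫ ū(x) v(ρx) dx` (the `k(ρ)` of Lemma 5.2), written with the
tree's `scalingCoeff u v τ = ⟨u|ϑ(e^τ)v⟩` at `τ = −log ρ`.  On function representatives; insensitive to
a.e. modification of either argument.  RH-FREE.
[cite: ConnesConsani2021, §4 eq. (40) p. 15 (arXiv p0015:L38–L41); Lemma 5.2 §5 p. 19 (arXiv p0019:L77)] -/
def repCoeff (u v : ℝ → ℂ) (ρ : ℝ) : ℂ :=
  scalingCoeff u v (-Real.log ρ)

/-- `⟨u|ϑ(ρ⁻¹)v⟩ = ∫ ū(x) ρ^{1/2} v(ρx) dx` for `ρ > 0` (unfolding `scalingCoeff`: `e^{−τ/2} = ρ^{1/2}`,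
`e^{−τ} = ρ` at `τ = −log ρ`).  PROVED. [cite: ConnesConsani2021, §4 eq. (40) p. 15 (arXiv p0015:L38–L41)] -/
theorem repCoeff_eq {ρ : ℝ} (hρ : 0 < ρ) (u v : ℝ → ℂ) :
    repCoeff u v ρ = ∫ x : ℝ, conj (u x) * (((Real.sqrt ρ : ℝ) : ℂ) * v (ρ * x)) := by
  have h1 : Real.exp (-(-Real.log ρ) / 2) = Real.sqrt ρ := by
    rw [neg_neg, Real.sqrt_eq_rpow, Real.rpow_def_of_pos hρ]
    congr 1; ring
  have h2 : Real.exp (-(-Real.log ρ)) = ρ := by rw [neg_neg, Real.exp_log hρ]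
  simp only [repCoeff, scalingCoeff, h1, h2]

end Coeff

/-! ## The prolate operator `𝐖`, the prolate functions at `λ = 1` (bandwidth `c = 2π`) and the eigenvalues `λ(n)` -/

section Prolate

/-- **The prolate (Slepian–Pollak) differential operator** `(W_λ ψ)(x) = −∂_x((λ² − x²)∂_x ψ(x)) + (2πλx)²ψ(x)`
(Connes 2026 Letter (6.3); CCM 2025 (7.5); the tree's `IsProlateFunction lam n f` axiomatises its
principal eigenfunctions); CC 2021's `𝐖` (display (WLambdaq), p. 16) is `prolateOp 1`:
`(𝐖ξ)(x) = −∂((1 − x²)∂)ξ(x) + (2πx)²ξ(x)`.  RH-FREE. [cite: ConnesConsani2021, §4 p. 16 eq. (WLambdaq) (arXiv p0016:L1–L7); Connes2026Letter, §6.3 eq. (6.3)] -/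
def prolateOp (lam : ℝ) (ψ : ℝ → ℝ) (x : ℝ) : ℝ :=
  -(deriv (fun y ↦ (lam ^ 2 - y ^ 2) * deriv ψ y) x) + (2 * π * lam * x) ^ 2 * ψ x

/-- A tree prolate function is an eigenfunction of `W_λ` on `(−λ, λ)` (the `eigen` field of
`IsProlateFunction`, read through `prolateOp`).  PROVED. [cite: Connes2026Letter, §6.3 eq. (6.3)] -/
theorem _root_.Literature.NumberTheory.LFunctions.IsProlateFunction.exists_prolateOp_eq
    {lam : ℝ} {n : ℕ} {f : ℝ → ℝ} (hf : IsProlateFunction lam n f) :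
    ∃ χ : ℝ, ∀ x ∈ Ioo (-lam) lam, prolateOp lam f x = χ * f x :=
  hf.eigen

/-- **CC's `φ_n`, normalised: the even prolate function with `2n` zeros at `λ = 1`, `c = 2π`** — THE
tree prolate function `h_{2n,1}` (`IsProlateFunction 1 (2n)`: principal eigenfunction of `𝐖 = prolateOp 1`
on `(−1,1)` with exactly `2n` zeros there, `∫_{−1}^{1} h² = 1`, `h(0) > 0`, `h = 0` off `[−1,1]`), chosen by
`exists_isProlateFunction` and unique by `IsProlateFunction.unique`; equals `PS_{2n,0}(2π, ·)|_{[−1,1]}` up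
to a nonzero scalar, and CC's unit vector `ξ_n = 𝒫₁φ_n/‖𝒫₁φ_n‖` is `±√2 · prolateFun n` pointwise in their
normalisation `⟨ξ|ξ⟩ = ∫₀^∞ |ξ|²` (module docstring).  RH-FREE.
[cite: ConnesConsani2021, §4 p. 16 eq. (prolateeq)–(cosalphan) (arXiv p0016:L17–L28); Prop. 4.5 (i) p. 16 (arXiv p0016:L50)] -/
def prolateFun (n : ℕ) : ℝ → ℝ :=
  Classical.choose (exists_isProlateFunction one_pos n)

/-- `prolateFun n` is the tree prolate function `h_{2n,1}`. [cite: ConnesConsani2021, §4 p. 16 (arXiv p0016:L17–L28)] -/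
theorem isProlateFunction_prolateFun (n : ℕ) : IsProlateFunction 1 (2 * n) (prolateFun n) :=
  Classical.choose_spec (exists_isProlateFunction one_pos n)

/-- Any `IsProlateFunction 1 (2n)` function IS `prolateFun n` (uniqueness, tree theorem
`IsProlateFunction.unique`); in particular seat t4's prolate families `ψ` with
`IsProlateFunction 1 (2n) (ψ n)` are `ψ = prolateFun`. [cite: ConnesConsani2021, §4 p. 16 (arXiv p0016:L17–L28)] -/
theorem eq_prolateFun_of_isProlateFunction {n : ℕ} {f : ℝ → ℝ} (hf : IsProlateFunction 1 (2 * n) f) :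
    f = prolateFun n :=
  hf.unique (isProlateFunction_prolateFun n)

/-- `prolateFun n` is even. [cite: ConnesConsani2021, §4 p. 16 ("these are even functions", arXiv p0016:L18)] -/
theorem prolateFun_neg (n : ℕ) (x : ℝ) : prolateFun n (-x) = prolateFun n x :=
  (isProlateFunction_prolateFun n).even x

/-- `prolateFun n` vanishes off `[−1, 1]`. [cite: ConnesConsani2021, §4 p. 16 (arXiv p0016:L25–L27)] -/
theorem prolateFun_eq_zero {n : ℕ} {x : ℝ} (hx : 1 < |x|) : prolateFun n x = 0 :=
  (isProlateFunction_prolateFun n).support x hx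

/-- `prolateFun n` vanishes outside `[−1, 1]` (set form). [cite: ConnesConsani2021, §4 p. 16 (arXiv p0016:L25–L27)] -/
theorem prolateFun_eq_zero_of_notMem {n : ℕ} {x : ℝ} (hx : x ∉ Icc (-1 : ℝ) 1) : prolateFun n x = 0 := by
  refine prolateFun_eq_zero ?_
  rw [mem_Icc, not_and_or, not_le, not_le] at hx
  rcases hx with h | h
  · rw [abs_of_neg (by linarith)]; linarith
  · rw [abs_of_pos (by linarith)]; exact h

/-- `prolateFun n 0 > 0`. [cite: ConnesConsani2021, §4 p. 16 (arXiv p0016:L17–L28)] -/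
theorem prolateFun_zero_pos (n : ℕ) : 0 < prolateFun n 0 :=
  (isProlateFunction_prolateFun n).pos_zero

/-- `prolateFun n` is its own restriction to `[−1,1]` (indicator form). [cite: ConnesConsani2021, §4 p. 16 (arXiv p0016:L25–L27)] -/
theorem prolateFun_eq_indicator (n : ℕ) : prolateFun n = (Icc (-1 : ℝ) 1).indicator (prolateFun n) := by
  funext x
  by_cases hx : x ∈ Icc (-1 : ℝ) 1
  · rw [indicator_of_mem hx]
  · rw [indicator_of_notMem hx, prolateFun_eq_zero_of_notMem hx]

/-- `∫_ℝ h_{2n,1} = ∫_{−1}^{1} h_{2n,1}` (support in `[−1,1]`).  PROVED. [cite: ConnesConsani2021, §4 p. 16 (arXiv p0016:L25–L27)] -/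
theorem integral_prolateFun (n : ℕ) :
    ∫ x, prolateFun n x = ∫ x in (-1 : ℝ)..1, prolateFun n x := by
  conv_lhs => rw [prolateFun_eq_indicator n]
  rw [integral_indicator measurableSet_Icc, integral_Icc_eq_integral_Ioc,
    ← intervalIntegral.integral_of_le (by norm_num : (-1 : ℝ) ≤ 1)]

/-- **The eigenvalue `λ(n)`** of the finite Fourier transform on the `n`-th even prolate function ("the
`λ_{2n}^c` (`c = 2π`) in the notations of [Wang]", p. 16), DEFINED through the eigen-relation (cosalphan)
evaluated at `ω = 0`: `∫ φ_n = λ(n) φ_n(0)`, `φ_n(0) ≠ 0` — the same formula as seat t4's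
`ArchimedeanTraceFormula.prolateLambda φ := (∫ φ)/φ(0)` at `φ = prolateFun n`; that this number is the
eigenvalue at every `ω ∈ [−1,1]` is the named fact `CC2021_sec4_cosalphan`.  Numerically (p. 16)
`λ(0) = 0.999971, λ(1) = −0.979485, λ(2) = 0.524086, λ(3) = −0.0589766, λ(4) = 0.00273233,
λ(5) = −0.0000762914` (`CC2021_sec4_lambda_numerics`).  RH-FREE.
[cite: ConnesConsani2021, §4 p. 16 eq. (prolateeq)–(cosalphan) (arXiv p0016:L17–L28)] -/
def prolateEigen (n : ℕ) : ℝ :=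
  (∫ x, prolateFun n x) / prolateFun n 0

/-- `λ(n) = (∫_{−1}^{1} h_{2n,1}) / h_{2n,1}(0)`.  PROVED. [cite: ConnesConsani2021, §4 p. 16 eq. (cosalphan) (arXiv p0016:L25–L28)] -/
theorem prolateEigen_eq_intervalIntegral (n : ℕ) :
    prolateEigen n = (∫ x in (-1 : ℝ)..1, prolateFun n x) / prolateFun n 0 := by
  rw [prolateEigen, integral_prolateFun]

/-- **(prolateeq)/(cosalphan) — Slepian–Pollak's "commuting miracle" (NAMED FACT, no proof claimed here)**:
the even prolate functions are eigenfunctions of the finite Fourier transform,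
`∫_{−1}^{1} PS_{2n,0}(2π, x) e^{i2πxω} dx = λ(n) PS_{2n,0}(2π, ω)` ((prolateeq), p. 16, for all real `ω` with
the entire extension of `PS`), typed in its restricted form (cosalphan) `𝒫₁𝔽_{e_ℝ}𝒫₁φ_n = λ(n)𝒫₁φ_n`, i.e.
for `ω ∈ [−1, 1]` and the tree prolate function (normalisation-free: the relation is linear).  Proved in
print by Slepian–Pollak 1961 (§III: `𝐖` commutes with `𝒫₁𝔽𝒫₁`, simple spectrum); Rokhlin–Xiao 2007
Thm. 4 (p. 110): "for each `n ≥ 0` the function `ψ_n` [the `n`-th eigenfunction of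
`F_c φ(x) = ∫_{−1}^{1} e^{icxt}φ(t)dt`] is the solution of `(1−x²)ψ″ − 2xψ′ + (χ_n − c²x²)ψ = 0`", `χ_n`
strictly increasing — so the eigenfunction of `𝐖` with `2n` zeros, `c = 2π`, is `prolateFun n` up to
scalar.  RH-FREE. [cite: ConnesConsani2021, §4 p. 16 eq. (prolateeq), (cosalphan) (arXiv p0016:L17–L28); RokhlinXiao2007, Thm. 3–4 pp. 109–110; SlepianPollak1961, §III] -/
def CC2021_sec4_cosalphan : Prop :=
  ∀ n : ℕ, ∀ ω ∈ Icc (-1 : ℝ) 1,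
    ∫ x in (-1 : ℝ)..1, (prolateFun n x : ℂ) * cexp (2 * π * I * x * ω) =
      (prolateEigen n : ℂ) * prolateFun n ω

/-- **The printed qualitative facts about the `λ(n)` (NAMED FACT, no proof claimed here)**: real with sign
`(−1)^n` and `|λ(n)| < 1` ("`λ_n = i^n|λ_n|`, all eigenvalues of `F_c` non-zero and simple", Rokhlin–Xiao
2007 Thm. 3 p. 109, at even index `2n`; `ν_n = λ(n)² < 1`, Connes 2026 Fact 6.3), the moduli STRICTLY
DECREASING ("`1 > ν_0(λ) > ν_1(λ) > … > 0`, simple", Letter Fact 6.3 at `λ = 1`, `ν_n(1) = λ(n)²`,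
`χ_n = λ(n)`, "the sign of `χ_m` is `(−1)^m`"), and `λ(n) → 0` ("all the further ones decay very fast to
`0`", CC p. 16; `ν_n(λ) → 0`, Fact 6.3).  RH-FREE.
[cite: ConnesConsani2021, §4 p. 16 (arXiv p0016:L22–L25); RokhlinXiao2007, Thm. 3 p. 109; Connes2026Letter, §6.3 Fact 6.3; SlepianPollak1961, §III] -/
def CC2021_sec4_lambda_basic : Prop :=
  (∀ n : ℕ, 0 < (-1 : ℝ) ^ n * prolateEigen n) ∧ (∀ n : ℕ, |prolateEigen n| < 1) ∧
    StrictAnti (fun n : ℕ ↦ |prolateEigen n|) ∧ Tendsto prolateEigen atTop (𝓝 0)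

/-- **The printed numerical values of `λ(0), …, λ(5)` (NAMED FACT, NUMERICAL-IN-PRINT: "given
numerically by the list", six significant digits, no error claim in print; typed as enclosures of one unit
in the last printed digit; no interval arithmetic claimed, none done here).**
[cite: ConnesConsani2021, §4 p. 16 (arXiv p0016:L22–L24)] -/
def CC2021_sec4_lambda_numerics : Prop :=
  |prolateEigen 0 - 0.999971| ≤ 1e-6 ∧ |prolateEigen 1 + 0.979485| ≤ 1e-6 ∧
    |prolateEigen 2 - 0.524086| ≤ 1e-6 ∧ |prolateEigen 3 + 0.0589766| ≤ 1e-7 ∧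
    |prolateEigen 4 - 0.00273233| ≤ 1e-8 ∧ |prolateEigen 5 + 0.0000762914| ≤ 1e-10

/-- Rokhlin–Xiao's bound `√π c^m (m!)² / ((2m)! Γ(m + 3/2))` for `|λ_m^c|` at `c = 2π`, `m = 2n`, i.e. CC's
`2^{2n} π^{2n+1/2} ((2n)!)² / ((4n)! Γ(2n + 3/2))` (display (rapid-decay), p. 16).  RH-FREE.
[cite: ConnesConsani2021, §4 p. 16 eq. (rapid-decay) (arXiv p0016:L34–L37); RokhlinXiao2007, Thm. 14 p. 117] -/
def rokhlinXiaoBound (n : ℕ) : ℝ :=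
  Real.sqrt π * (2 * π) ^ (2 * n) * ((2 * n).factorial : ℝ) ^ 2 /
    ((4 * n).factorial * Real.Gamma (2 * n + 3 / 2))

/-- **(rapid-decay) (NAMED FACT — CONJECTURE-CLASS IN PRINT (cc ruling R64); no proof claimed here)**,
as printed by CC (p. 16, "see [Rokhlin], Theorem 14, and Appendix E"): for every `n`,
`|λ(n)| ≤ 2^{2n}π^{2n+1/2}((2n)!)²/((4n)! Γ(2n+3/2))` (`rokhlinXiaoBound n`), and this bound is
asymptotically `∼ (4n+1)^{−2n−1/2}(eπ)^{2n+1/2}`.  STATUS OF THE CITED SOURCE (Rokhlin–Xiao 2007, read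
first-hand, cc seat t8): Theorem 9 (p. 114, (57)–(58): `λ_m^c = i^m ν(m,c) e^{F(c)}` with
`ν(m,c) = √π c^m (m!)²/((2m)! Γ(m+3/2))`) IS proved there; Theorem 14 (p. 117: `|λ_m^c| < ν(m,c)` for
`c > 0` fixed and `m` sufficiently large) is obtained "by substituting (67) into (58)", where (66)/(67)
(Theorems 12–13) are formal computer-algebra expansions of `ψ_m^c(1)` in powers of `1/m` printed WITHOUT a
remainder estimate (§4 opening, p. 114) — so the inequality is PROVED (Thm. 9) + UNPROVED EXPANSION
((66)/(67)) in print: conjecture-class, exactly like the companion assumption `ψ_m^c(1)² < m + 1/2`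
(Thm. 12 (66)).  CC state it for ALL `n` at `c = 2π`, `m = 2n` and use it for `n ≥ 3` (App. E, proof of
Lemma E.1, arXiv p0035:L87).  The SECOND conjunct (Stirling asymptotics of the bound) is elementary and is
PROVED in the tree (`isEquivalent_rokhlinXiaoBound`, module `ProlateEigenvalueBoundAsymptotics`;
`CC2021_sec4_rapidDecay_of_abs_le`), so this fact is equivalent to its first clause.  PROVED-IN-PRINT
SUBSTITUTE (the eigenvalue-decay input of record for the archimedean-density lemmas, cc R64 (2)):
Osipov 2013, Thm. 33 (explicit super-geometric bounds for `m > 2c/π + √42`, i.e. eventually in `n`),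
typed as `Osipov2013_thm_33` (module `Literature.NumberTheory.LFunctions.ProlateEigenvalueDecay`).
This fact is therefore NOT to be used as the Literature boundary of a closer; it is kept (never weakened in
place) while conditional theorems consume it as an explicit hypothesis.  Numerics against the printed
`λ(n)`: bound `= 2, 3.51, 0.754, 0.0631, 2.80·10⁻³, 7.73·10⁻⁵` vs `|λ(n)| = 1.00, 0.979, 0.524, 0.0590,
2.73·10⁻³, 7.63·10⁻⁵` for `n = 0..5` (margins `1.07, 1.026, 1.013` at `n = 3, 4, 5`).  RH-FREE; not
certified here.
Claim locator: Rokhlin–Xiao 2007, Thm. 14 p. 117 (via the proved Thm. 9 (57)–(58) p. 114 and the unproved expansion (67); no proof with a remainder estimate in print). [claim: RokhlinXiao2007, status: under-review]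
[cite: ConnesConsani2021, §4 p. 16 eq. (rapid-decay) (arXiv p0016:L34–L37); RokhlinXiao2007, Thm. 9 p. 114, Thm. 14 p. 117] -/
def CC2021_sec4_rapidDecay : Prop :=
  (∀ n : ℕ, |prolateEigen n| ≤ rokhlinXiaoBound n) ∧
    Asymptotics.IsEquivalent atTop rokhlinXiaoBound
      (fun n : ℕ ↦ (4 * n + 1 : ℝ) ^ (-(2 * n + 1 / 2 : ℝ)) * (Real.exp 1 * π) ^ (2 * n + 1 / 2 : ℝ))

end Prolate

/-! ## The prolate vectors `ξ_n, η_n, ψ_n, ζ_n` (Proposition 4.5): function representatives and `L²` classes -/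

section Vectors

/-- **`ξ_n` as a function**: the complexified prolate function `x ↦ prolateFun n x` (zero off `[−1,1]`;
CC's `ξ_n = 𝒫₁φ_n/‖𝒫₁φ_n‖ = √2 ·` this, pointwise, in their normalisation).  RH-FREE.
[cite: ConnesConsani2021, Prop. 4.5 (i) §4 p. 16 (arXiv item Proposition 25, p0016:L50)] -/
def prolateXiFun (n : ℕ) : ℝ → ℂ := fun x ↦ (prolateFun n x : ℂ)

/-- `ξ_n` is supported in `[−1, 1]`. [cite: ConnesConsani2021, Prop. 4.5 (i) §4 p. 16 (arXiv p0016:L50)] -/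
theorem prolateXiFun_eq_indicator (n : ℕ) :
    prolateXiFun n = (Icc (-1 : ℝ) 1).indicator (prolateXiFun n) := by
  funext x
  by_cases hx : x ∈ Icc (-1 : ℝ) 1
  · rw [indicator_of_mem hx]
  · rw [indicator_of_notMem hx]
    simp [prolateXiFun, prolateFun_eq_zero_of_notMem hx]

/-- `ξ_n` is continuous on `[−1, 1]`. [cite: ConnesConsani2021, Prop. 4.5 (i) §4 p. 16 (arXiv p0016:L50)] -/
theorem continuousOn_prolateXiFun (n : ℕ) : ContinuousOn (prolateXiFun n) (Icc (-1 : ℝ) 1) :=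
  continuous_ofReal.comp_continuousOn (isProlateFunction_prolateFun n).contDiffOn.continuousOn

/-- `ξ_n ∈ L²(ℝ)` (bounded with compact support).  PROVED. [cite: ConnesConsani2021, Prop. 4.5 (i) §4 p. 16 (arXiv p0016:L50)] -/
theorem memLp_prolateXiFun (n : ℕ) : MemLp (prolateXiFun n) 2 (volume : Measure ℝ) := by
  rw [prolateXiFun_eq_indicator, memLp_indicator_iff_restrict measurableSet_Icc]
  haveI : IsFiniteMeasure ((volume : Measure ℝ).restrict (Icc (-1 : ℝ) 1)) :=
    isFiniteMeasure_restrict.2 measure_Icc_lt_top.ne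
  obtain ⟨C, hC⟩ := isCompact_Icc.exists_bound_of_continuousOn (continuousOn_prolateXiFun n)
  exact MemLp.of_bound ((continuousOn_prolateXiFun n).aestronglyMeasurable measurableSet_Icc) C
    ((ae_restrict_iff' measurableSet_Icc).mpr (Eventually.of_forall hC))

/-- `ξ_n ∈ L¹(ℝ)`.  PROVED. [cite: ConnesConsani2021, Prop. 4.5 (i) §4 p. 16 (arXiv p0016:L50)] -/
theorem integrable_prolateXiFun (n : ℕ) : Integrable (prolateXiFun n) (volume : Measure ℝ) := by
  rw [prolateXiFun_eq_indicator, integrable_indicator_iff measurableSet_Icc]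
  exact (continuousOn_prolateXiFun n).integrableOn_compact isCompact_Icc

/-- **`ξ_n ∈ L²(ℝ)`**: CC's unit vector `ξ_n = 𝒫₁φ_n/‖𝒫₁φ_n‖` of Prop. 4.5 (i), as the `L²` class of the
tree prolate function.  RH-FREE. [cite: ConnesConsani2021, Prop. 4.5 (i) §4 p. 16 (arXiv item Proposition 25, p0016:L50)] -/
def prolateXi (n : ℕ) : Lp ℂ 2 (volume : Measure ℝ) := (memLp_prolateXiFun n).toLp _

/-- `ξ_n` (the `L²` class) is `prolateXiFun n` a.e. [cite: ConnesConsani2021, Prop. 4.5 (i) §4 p. 16 (arXiv p0016:L50)] -/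
theorem prolateXi_coeFn (n : ℕ) : (prolateXi n : ℝ → ℂ) =ᵐ[volume] prolateXiFun n :=
  MemLp.coeFn_toLp _

/-- `ξ_n` is even: `ξ_n ∈ L²(ℝ)_ev`.  PROVED. [cite: ConnesConsani2021, Prop. 4.5 (i) §4 p. 16 (arXiv p0016:L50)] -/
theorem prolateXi_mem_evenPart (n : ℕ) : prolateXi n ∈ evenPart := by
  rw [mem_evenPart_iff]
  have h := prolateXi_coeFn n
  filter_upwards [h,
    (Measure.measurePreserving_neg (volume : Measure ℝ)).quasiMeasurePreserving.ae_eq_comp h]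
    with x hx hx'
  simp only [Function.comp_apply] at hx'
  rw [hx', hx]
  simp [prolateXiFun, prolateFun_neg]

/-- `𝒫₁ ξ_n = ξ_n` (`ξ_n` lies in the range of `𝒫₁`).  PROVED. [cite: ConnesConsani2021, Prop. 4.5 (i) §4 p. 16 (arXiv p0016:L50)] -/
theorem cutoffProj_prolateXi (n : ℕ) : cutoffProj 1 (prolateXi n) = prolateXi n := by
  apply Lp.ext
  filter_upwards [cutoffProj_coeFn 1 (prolateXi n), prolateXi_coeFn n] with x h1 h2
  rw [h1]
  by_cases hx : x ∈ Icc (-1 : ℝ) 1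
  · rw [indicator_of_mem hx]
  · rw [indicator_of_notMem hx, h2, prolateXiFun_eq_indicator, indicator_of_notMem hx]

/-- `P ξ_n = 0`.  PROVED. [cite: ConnesConsani2021, Prop. 4.5 (i) §4 p. 16 (arXiv p0016:L50)] -/
theorem outerProj_prolateXi (n : ℕ) : outerProj (prolateXi n) = 0 := by
  rw [outerProj_apply, cutoffProj_prolateXi, sub_self]

/-- **`‖ξ_n‖ = 1`** (`∫_{−1}^{1} h_{2n,1}² = 1`).  PROVED. [cite: ConnesConsani2021, Prop. 4.5 (i) §4 p. 16 (arXiv p0016:L50)] -/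
theorem norm_prolateXi (n : ℕ) : ‖prolateXi n‖ = 1 := by
  have hf := isProlateFunction_prolateFun n
  have hsq : ‖prolateXi n‖ ^ 2 = 1 := by
    rw [← inner_self_eq_norm_sq (𝕜 := ℂ) (prolateXi n), L2.inner_def]
    have h1 : ∫ x : ℝ, ⟪(prolateXi n : ℝ → ℂ) x, (prolateXi n : ℝ → ℂ) x⟫_ℂ =
        ∫ x : ℝ, ((prolateFun n x ^ 2 : ℝ) : ℂ) := by
      refine integral_congr_ae ?_
      filter_upwards [prolateXi_coeFn n] with x hx
      rw [hx]
      simp only [prolateXiFun, RCLike.inner_apply, conj_ofReal]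
      push_cast
      ring
    rw [h1, integral_complex_ofReal, RCLike.re_to_complex, ofReal_re]
    have h2 : (fun x : ℝ => prolateFun n x ^ 2) =
        (Icc (-1 : ℝ) 1).indicator fun x => prolateFun n x ^ 2 := by
      funext x
      by_cases hx : x ∈ Icc (-1 : ℝ) 1
      · rw [indicator_of_mem hx]
      · rw [indicator_of_notMem hx, prolateFun_eq_zero_of_notMem hx]; simp
    rw [h2, integral_indicator measurableSet_Icc, integral_Icc_eq_integral_Ioc,
      ← intervalIntegral.integral_of_le (by norm_num : (-1 : ℝ) ≤ 1), hf.norm_one]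
  have h0 : 0 ≤ ‖prolateXi n‖ := norm_nonneg _
  nlinarith [hsq, h0]

/-- **`η_n` as a function**: the Fourier integral `η_n(y) = 𝓕ξ_n(y) = ∫ ξ_n(x)e^{−2πixy}dx =
2∫₀¹ h_{2n,1}(x)cos(2πxy)dx` (continuous; "the function `𝔽_{e_ℝ}ξ_n` is smooth, as the Fourier transform of
a function with compact support", Rem. 4.6).  RH-FREE.
[cite: ConnesConsani2021, Prop. 4.5 (i) §4 p. 16 (arXiv item Proposition 25, p0016:L50); Remark 4.6 (i) p. 18 (arXiv p0018:L5)] -/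
def prolateEtaFun (n : ℕ) : ℝ → ℂ := 𝓕 (prolateXiFun n)

/-- **`η_n = 𝔽_{e_ℝ} ξ_n ∈ L²(ℝ)`** (Mathlib's unitary `L²` Fourier transform of `ξ_n`).  RH-FREE.
[cite: ConnesConsani2021, Prop. 4.5 (i) §4 p. 16 (arXiv item Proposition 25, p0016:L50)] -/
def prolateEta (n : ℕ) : Lp ℂ 2 (volume : Measure ℝ) :=
  (𝓕 (prolateXi n) : Lp ℂ 2 (volume : Measure ℝ))

/-- The `L²` transform `η_n` IS the Fourier integral of `ξ_n` a.e. (`ξ_n ∈ L¹ ∩ L²`; the tree's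
`FourierNS.fourier_toLp_ae_eq`).  PROVED. [cite: ConnesConsani2021, Prop. 4.5 (i) §4 p. 16 (arXiv p0016:L50)] -/
theorem prolateEta_coeFn (n : ℕ) : (prolateEta n : ℝ → ℂ) =ᵐ[volume] prolateEtaFun n :=
  Literature.Analysis.FluidPDE.FourierNS.fourier_toLp_ae_eq (integrable_prolateXiFun n)
    (memLp_prolateXiFun n)

/-- `‖η_n‖ = 1` (Plancherel; first display of the proof of Prop. 4.5 (iii)).  PROVED.
[cite: ConnesConsani2021, Prop. 4.5 (iii) proof §4 p. 17 (arXiv p0017:L26)] -/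
theorem norm_prolateEta (n : ℕ) : ‖prolateEta n‖ = 1 := by
  rw [prolateEta, Lp.norm_fourier_eq, norm_prolateXi]

/-- **`ψ_n` as a function**: `ψ_n = P η_n`, the part of `η_n` at `|v| ≥ 1` (the tree's function-level
`SchwartzKernels.cutoffP` applied to `η_n`; the same formula as seat t4's
`ArchimedeanTraceFormula.prolateCutFourier (prolateFun n)`).  RH-FREE.
[cite: ConnesConsani2021, Prop. 4.5 (i) §4 p. 16 (arXiv item Proposition 25, p0016:L50)] -/
def prolatePsiFun (n : ℕ) : ℝ → ℂ := cutoffP (prolateEtaFun n)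

/-- **`ψ_n := P η_n ∈ L²(ℝ)`** (Prop. 4.5 (i)).  RH-FREE. [cite: ConnesConsani2021, Prop. 4.5 (i) §4 p. 16 (arXiv item Proposition 25, p0016:L50)] -/
def prolatePsi (n : ℕ) : Lp ℂ 2 (volume : Measure ℝ) := outerProj (prolateEta n)

/-- `ψ_n` (the `L²` class) is `prolatePsiFun n` a.e.  PROVED. [cite: ConnesConsani2021, Prop. 4.5 (i) §4 p. 16 (arXiv p0016:L50)] -/
theorem prolatePsi_coeFn (n : ℕ) : (prolatePsi n : ℝ → ℂ) =ᵐ[volume] prolatePsiFun n := by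
  rw [prolatePsi]
  filter_upwards [outerProj_coeFn (prolateEta n), prolateEta_coeFn n] with x h1 h2
  rw [h1, prolatePsiFun, cutoffP, cutoffP, h2]

/-- **`ζ_n` as a function**: `ζ_n = ψ_n/√(1 − λ(n)²)`.  RH-FREE. [cite: ConnesConsani2021, Prop. 4.5 (iii) §4 p. 16 eq. (smaller) (arXiv p0016:L56–L59)] -/
def prolateZetaFun (n : ℕ) : ℝ → ℂ :=
  fun v ↦ (((Real.sqrt (1 - prolateEigen n ^ 2))⁻¹ : ℝ) : ℂ) * prolatePsiFun n v

/-- **`ζ_n := ψ_n / √(1 − λ(n)²) ∈ L²(ℝ)`** (Prop. 4.5 (iii); a unit vector by (iii)).  RH-FREE.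
[cite: ConnesConsani2021, Prop. 4.5 (iii) §4 p. 16 eq. (smaller) (arXiv item Proposition 25, p0016:L56–L59)] -/
def prolateZeta (n : ℕ) : Lp ℂ 2 (volume : Measure ℝ) :=
  (((Real.sqrt (1 - prolateEigen n ^ 2))⁻¹ : ℝ) : ℂ) • prolatePsi n

/-- `ζ_n` (the `L²` class) is `prolateZetaFun n` a.e.  PROVED. [cite: ConnesConsani2021, Prop. 4.5 (iii) §4 p. 16 (arXiv p0016:L56–L59)] -/
theorem prolateZeta_coeFn (n : ℕ) : (prolateZeta n : ℝ → ℂ) =ᵐ[volume] prolateZetaFun n := by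
  rw [prolateZeta]
  filter_upwards [Lp.coeFn_smul ((((Real.sqrt (1 - prolateEigen n ^ 2))⁻¹ : ℝ) : ℂ)) (prolatePsi n),
    prolatePsi_coeFn n] with x h1 h2
  rw [h1, Pi.smul_apply, h2, smul_eq_mul]
  rfl

/-- **`τ(n) := λ(n)/√(1 − λ(n)²)`** (Prop. 4.5 (iv)).  RH-FREE. [cite: ConnesConsani2021, Prop. 4.5 (iv) §4 p. 16 (arXiv item Proposition 25, p0016:L60)] -/
def prolateTau (n : ℕ) : ℝ := prolateEigen n / Real.sqrt (1 - prolateEigen n ^ 2)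

end Vectors

/-! ## The statements: Lemma 4.1, (cosalpha)/(cosalphan1), Proposition 4.5, eq. (spectral), Remark 4.6 -/

section Statements

/-- **"The vectors `ξ_n` form an orthonormal basis of the range of `𝒫₁`" — orthonormality (NAMED FACT, no
proof claimed here; Sturm–Liouville orthogonality of eigenfunctions of `𝐖` with distinct eigenvalues plus
`‖ξ_n‖ = 1` (`norm_prolateXi`, PROVED), left for the discharge pass).**  RH-FREE.
[cite: ConnesConsani2021, Prop. 4.5 proof §4 p. 17 (arXiv p0017:L2); RokhlinXiao2007, Thm. 3 p. 109] -/
def CC2021_sec4_xi_orthonormal : Prop :=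
  Orthonormal ℂ prolateXi

/-- **"The vectors `ξ_n` form an orthonormal basis of the range of `𝒫₁`" [in `L²(ℝ)_ev`] — completeness
(NAMED FACT, no proof claimed here)**: an even `ξ ∈ L²(ℝ)` supported in `[−1,1]` and orthogonal to every
`ξ_n` vanishes ("the eigenfunctions `ψ_0, ψ_1, …` of `F_c` are … orthonormal and complete in `L²[−1,1]`",
Rokhlin–Xiao 2007 Thm. 3; the even-indexed ones span the even part).  RH-FREE.
[cite: ConnesConsani2021, Prop. 4.5 proof §4 p. 17 (arXiv p0017:L2); RokhlinXiao2007, Thm. 3 p. 109; SlepianPollak1961, §III] -/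
def CC2021_sec4_xi_complete : Prop :=
  ∀ ξ : Lp ℂ 2 (volume : Measure ℝ), ξ ∈ evenPart → cutoffProj 1 ξ = ξ →
    (∀ n : ℕ, ⟪prolateXi n, ξ⟫_ℂ = 0) → ξ = 0

/-- **(cosalpha)/(cosalphan1), "`cos α(n) = |λ(n)|`" and "`∠(𝒫₁,𝒫̂₁)|_{S(1,1)} = 0`" (NAMED FACT, no proof
claimed here)**: `ξ_n` and `η_n` are eigenvectors of the angle operator `α = ∠(𝒫₁, 𝒫̂₁)` with eigenvalue
`α(n) = arccos|λ(n)|` ((cosalphan1) `𝒫₁𝒫̂₁𝒫₁φ_n = λ(n)²𝒫₁φ_n`, (cosalpha) `𝒫₁𝒫̂₁𝒫₁ = cos²(α)𝒫₁`, and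
`ξ_n, η_n ∈ E_n`, proof of Prop. 4.5 (iii)), these are ALL the non-zero eigenvalues of `α` on `L²(ℝ)_ev`
("the non-zero eigenvalues `α(n)` of `α` are given by `cos α(n) = |λ(n)|`", p. 16), and `α` vanishes on
Sonin's space `S(1,1)`.  RH-FREE. [cite: ConnesConsani2021, §4 p. 16 eq. (cosalpha), (cosalphan1) (arXiv p0016:L13–L16, L29–L34, L39); Prop. 4.5 (iii) proof p. 17 (arXiv p0017:L41–L57)] -/
def CC2021_sec4_angle_spectrum : Prop :=
  (∀ n : ℕ,
    angleOp (cutoffProj 1) (cutoffProjHat 1) (prolateXi n) = (Real.arccos |prolateEigen n| : ℂ) • prolateXi n ∧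
      angleOp (cutoffProj 1) (cutoffProjHat 1) (prolateEta n) =
        (Real.arccos |prolateEigen n| : ℂ) • prolateEta n) ∧
  (∀ ξ : Lp ℂ 2 (volume : Measure ℝ), ξ ∈ evenPart → ξ ≠ 0 → ∀ μ : ℂ, μ ≠ 0 →
      angleOp (cutoffProj 1) (cutoffProjHat 1) ξ = μ • ξ → ∃ n : ℕ, μ = (Real.arccos |prolateEigen n| : ℂ)) ∧
  (∀ ξ ∈ soninSpace 1 1, angleOp (cutoffProj 1) (cutoffProjHat 1) ξ = 0)

/-- **Lemma 4.1 (= arXiv Lemma 21, (disponequa)) in `L²(ℝ)_ev`, eq. (1quantum) `δ(ρ) = Tr(ϑ(ρ⁻¹)𝒫̂₁𝒫₁)`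
(NAMED FACT, no proof claimed here)**, with the trace computed, as in the printed proof of Prop. 4.5 (ii)
(first display, p. 17), in the orthonormal basis `(ξ_n)` of `𝒫₁L²(ℝ)_ev` (the operator kills `(1−𝒫₁)L²`):
for `ρ ≥ 1`, `Σ_n ⟨ξ_n|ϑ(ρ⁻¹)𝒫̂₁𝒫₁ξ_n⟩ = δ(ρ)` with `δ = traceRemainder` (Def. 2.1 recast, the tree's
`SchwartzKernels`).  RH-FREE.
[cite: ConnesConsani2021, Lemma 4.1 §4 p. 15 (arXiv item Lemma 21, p0015:L12–L13; eq. (1quantum) p0015:L49–L52); Prop. 4.5 (ii) proof p. 17 (arXiv p0017:L2–L15)] -/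
def CC2021_lem_4_1 : Prop :=
  ∀ ρ : ℝ, 1 ≤ ρ →
    HasSum (fun n : ℕ ↦
        repCoeff (prolateXiFun n)
          ((cutoffProjHat 1 (cutoffProj 1 (prolateXi n)) : Lp ℂ 2 (volume : Measure ℝ)) : ℝ → ℂ) ρ)
      (traceRemainder ρ : ℂ)

/-- **Proposition 4.5 (i), eq. (chirem0.5) (NAMED FACT, no proof claimed here; follows from
`CC2021_sec4_cosalphan`, left for the discharge pass)**: `𝒫₁η_n = 𝒫₁𝔽_{e_ℝ}ξ_n = λ(n)ξ_n`.  RH-FREE.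
[cite: ConnesConsani2021, Prop. 4.5 (i) §4 p. 16 eq. (chirem0.5) (arXiv item Proposition 25, p0016:L50–L51)] -/
def CC2021_prop_4_5_i : Prop :=
  ∀ n : ℕ, cutoffProj 1 (prolateEta n) = (prolateEigen n : ℂ) • prolateXi n

/-- **Proposition 4.5 (ii), eq. (chirem1) (NAMED FACT, no proof claimed here)**: for `ρ ≥ 1`,
`δ(ρ) = Tr(ϑ(ρ⁻¹)𝒫̂₁𝒫₁) = Σ_n (λ(n)²⟨ξ_n|ϑ(ρ⁻¹)ξ_n⟩ + λ(n)⟨ξ_n|ϑ(ρ⁻¹)ψ_n⟩)`, with `δ = traceRemainder`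
(the middle term is `CC2021_lem_4_1`).  RH-FREE.
[cite: ConnesConsani2021, Prop. 4.5 (ii) §4 p. 16 eq. (chirem1) (arXiv item Proposition 25, p0016:L52–L55)] -/
def CC2021_prop_4_5_ii : Prop :=
  ∀ ρ : ℝ, 1 ≤ ρ →
    HasSum (fun n : ℕ ↦
        (prolateEigen n : ℂ) ^ 2 * repCoeff (prolateXiFun n) (prolateXiFun n) ρ +
          (prolateEigen n : ℂ) * repCoeff (prolateXiFun n) (prolatePsiFun n) ρ)
      (traceRemainder ρ : ℂ)

/-- **Proposition 4.5 (iii) (NAMED FACT, no proof claimed here; elementary given (i) and the orthonormality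
of the `ξ_n`, left for the discharge pass)**: "The functions `ψ_n = P𝔽_{e_ℝ}ξ_n` are real valued, pairwise
orthogonal and `‖ψ_n‖ = √(1 − λ(n)²)`, (smaller) `Σ λ(n)²|ζ_n⟩⟨ζ_n| ≤ P P̂ P`, `ζ_n = ψ_n/√(1−λ(n)²)`" —
the operator inequality typed on `L²(ℝ)_ev` through finite partial sums of the quadratic forms,
`⟨ξ|PP̂Pξ⟩ = ‖P̂Pξ‖²`.  RH-FREE.
[cite: ConnesConsani2021, Prop. 4.5 (iii) §4 p. 16 eq. (smaller) (arXiv item Proposition 25, p0016:L56–L59)] -/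
def CC2021_prop_4_5_iii : Prop :=
  (∀ n : ℕ, ∀ v : ℝ, conj (prolatePsiFun n v) = prolatePsiFun n v) ∧
  (∀ n m : ℕ, n ≠ m → ⟪prolatePsi n, prolatePsi m⟫_ℂ = 0) ∧
  (∀ n : ℕ, ‖prolatePsi n‖ = Real.sqrt (1 - prolateEigen n ^ 2)) ∧
  (∀ ξ : Lp ℂ 2 (volume : Measure ℝ), ξ ∈ evenPart → ∀ s : Finset ℕ,
      ∑ n ∈ s, prolateEigen n ^ 2 * ‖⟪prolateZeta n, ξ⟫_ℂ‖ ^ 2 ≤ ‖outerProjHat (outerProj ξ)‖ ^ 2)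

/-- **Eq. (spectral) (proof of Prop. 4.5 (iii); the input (sonine2) of the proof of Thm. 4.7) (NAMED FACT, no
proof claimed here)**: on `L²(ℝ)_ev`, `P P̂ P = Σ_n λ(n)²|ζ_n⟩⟨ζ_n| + 𝐒` with `𝐒 = soninProjection 1 1` the
orthogonal projection onto Sonin's space ("`R` is the orthogonal projection on Sonin's space `S(1,1)`";
"Sonin's space is the eigenspace of `PP̂P` for the eigenvalue `1`, so that `R = 𝐒`", p. 18), typed
vector-wise.  RH-FREE.
[cite: ConnesConsani2021, Prop. 4.5 (iii) proof §4 p. 17 eq. (spectral) (arXiv p0017:L59–L63); Thm. 4.7 proof p. 18 eq. (sonine2) (arXiv p0018:L77–L79)] -/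
def CC2021_prop_4_5_spectral : Prop :=
  ∀ ξ : Lp ℂ 2 (volume : Measure ℝ), ξ ∈ evenPart →
    HasSum (fun n : ℕ ↦ ((prolateEigen n : ℂ) ^ 2 * ⟪prolateZeta n, ξ⟫_ℂ) • prolateZeta n)
      (outerProj (outerProjHat (outerProj ξ)) - soninProjection 1 1 ξ)

/-- **Proposition 4.5 (iv), eq. (hattrick) (NAMED FACT, no proof claimed here; elementary given (i) and the
unitarity of `ϑ`, `𝔽`, left for the discharge pass)**: with `τ(n) = λ(n)/√(1−λ(n)²)`,
`⟨ξ_n|ϑ(ρ⁻¹)ξ_n⟩ = ⟨ζ_n|ϑ(ρ⁻¹)ζ_n⟩ + τ(n)(⟨ξ_n|ϑ(ρ⁻¹)ζ_n⟩ + ⟨ζ_n|ϑ(ρ⁻¹)ξ_n⟩)` (every `ρ > 0`; the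
printed proof uses no restriction on `ρ`).  RH-FREE.
[cite: ConnesConsani2021, Prop. 4.5 (iv) §4 p. 16 eq. (hattrick) (arXiv item Proposition 25, p0016:L60–L64)] -/
def CC2021_prop_4_5_iv : Prop :=
  ∀ n : ℕ, ∀ ρ : ℝ, 0 < ρ →
    repCoeff (prolateXiFun n) (prolateXiFun n) ρ =
      repCoeff (prolateZetaFun n) (prolateZetaFun n) ρ +
        (prolateTau n : ℂ) *
          (repCoeff (prolateXiFun n) (prolateZetaFun n) ρ + repCoeff (prolateZetaFun n) (prolateXiFun n) ρ)

/-- **Remark 4.6 (i): `δ(1) = Σ λ(n)²` (NAMED FACT, no proof claimed here)** ("Equality (chirem1) implies in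
particular that `δ(1) = Σ λ(n)²`, i.e. `2(Si(4π)/(4π) + 1) = Σ λ(n)²`"; the closed form of `δ(1)` is the
tree's `traceRemainder_one`, whence the `Si` form below).  RH-FREE.
[cite: ConnesConsani2021, Remark 4.6 (i) §4 p. 18 (arXiv item Remark 26, p0018:L1–L5)] -/
def CC2021_rem_4_6_i : Prop :=
  HasSum (fun n : ℕ ↦ prolateEigen n ^ 2) (traceRemainder 1)

/-- Remark 4.6 (i) in its `Si` form: `Σ λ(n)² = 2(Si(4π)/(4π) + 1)` — from `CC2021_rem_4_6_i` and the
tree's `traceRemainder_one` (PROVED reduction). [cite: ConnesConsani2021, Remark 4.6 (i) §4 p. 18 (arXiv item Remark 26, p0018:L2–L4)] -/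
theorem CC2021_rem_4_6_i.hasSum_sinIntegral (h : CC2021_rem_4_6_i) :
    HasSum (fun n : ℕ ↦ prolateEigen n ^ 2) (2 * (sinIntegral (4 * π) / (4 * π) + 1)) := by
  have h' : HasSum (fun n : ℕ ↦ prolateEigen n ^ 2) (traceRemainder 1) := h
  rwa [traceRemainder_one] at h'

/-- **Remark 4.6 (i): `Σ λ(n)² ξ_n(1)² = 2` (NAMED FACT, no proof claimed here; PROVED in print from
`δ′(1⁺) = 1`, eq. (sch18.5) of §2, and `ψ_n(1) = λ(n)ξ_n(1)`)**, in CC's pointwise normalisation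
`ξ_n = √2 · prolateFun n` (module docstring; equivalently `Σ λ(n)² h_{2n,1}(1)² = 1`).  RH-FREE.
[cite: ConnesConsani2021, Remark 4.6 (i) §4 p. 18 (arXiv item Remark 26, p0018:L5–L15)] -/
def CC2021_rem_4_6_i_pointwise : Prop :=
  HasSum (fun n : ℕ ↦ prolateEigen n ^ 2 * (Real.sqrt 2 * prolateFun n 1) ^ 2) 2

/-- **Remark 4.6 (i), the numerical check (NAMED FACT, NUMERICAL-IN-PRINT: "one checks numerically that both
sides are `∼ 2.237484835`"; typed for the closed-form side `δ(1) = 2(Si(4π)/(4π) + 1)` as an enclosure of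
one unit in the last printed digit; no interval arithmetic claimed, none done here).**
[cite: ConnesConsani2021, Remark 4.6 (i) §4 p. 18 (arXiv item Remark 26, p0018:L2–L5)] -/
def CC2021_rem_4_6_i_numerics : Prop :=
  |traceRemainder 1 - 2.237484835| ≤ 1e-9

/-- **Remark 4.6 (ii), eq. (sym1) (NAMED FACT, no proof claimed here; a support computation, left for the
discharge pass)**: for `ρ ≥ 1`, `⟨ψ_n|ϑ(ρ⁻¹)ξ_n⟩ = 0` and `⟨ζ_n|ϑ(ρ⁻¹)ξ_n⟩ = 0` ("since `ξ_n(ρx) = 0` for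
`|x| > 1`").  RH-FREE. [cite: ConnesConsani2021, Remark 4.6 (ii) §4 p. 18 eq. (sym1) (arXiv item Remark 26, p0018:L17–L24)] -/
def CC2021_rem_4_6_ii : Prop :=
  ∀ n : ℕ, ∀ ρ : ℝ, 1 ≤ ρ →
    repCoeff (prolatePsiFun n) (prolateXiFun n) ρ = 0 ∧ repCoeff (prolateZetaFun n) (prolateXiFun n) ρ = 0

/-- **Remark 4.6 (ii), the symmetric form of (chirem1) valid for all `ρ > 0` (NAMED FACT, no proof claimed
here)**: replacing `⟨ξ_n|ϑ(ρ⁻¹)ψ_n⟩` by `⟨ξ_n|ϑ(ρ⁻¹)ψ_n⟩ + ⟨ξ_n|ϑ(ρ)ψ_n⟩` ("invariant under `ρ ↦ ρ⁻¹`"),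
"(chirem1) is valid for all `ρ ∈ ℝ₊*`" (`δ(ρ) = δ(ρ⁻¹)`: the tree's `traceRemainder_inv`).  RH-FREE.
[cite: ConnesConsani2021, Remark 4.6 (ii) §4 p. 18 (arXiv item Remark 26, p0018:L25–L29)] -/
def CC2021_rem_4_6_ii_sym : Prop :=
  ∀ ρ : ℝ, 0 < ρ →
    HasSum (fun n : ℕ ↦
        (prolateEigen n : ℂ) ^ 2 * repCoeff (prolateXiFun n) (prolateXiFun n) ρ +
          (prolateEigen n : ℂ) *
            (repCoeff (prolateXiFun n) (prolatePsiFun n) ρ + repCoeff (prolateXiFun n) (prolatePsiFun n) ρ⁻¹))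
      (traceRemainder ρ : ℂ)

end Statements

end Literature.NumberTheory.ConnesConsani2021

end
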